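import Literature.NumberTheory.Automorphic.CaraianiNewtonModularity
import HarnessLib

/-!
# Caraiani–Newton modularity (Thm. 1.1 = Cor. 7.1.2): proofs file

The hypothesis curve `X₀(15)` and the explicit algebra of §7 of the source.

Sibling proofs file of `Literature.NumberTheory.Automorphic.CaraianiNewtonModularity`, whose named
fact `CaraianiNewton2023_modularity` renders A. Caraiani, J. Newton, *On the modularity of elliptic
curves over imaginary quadratic fields*, arXiv:2301.10509, Thm. 1.1 (= Cor. 7.1.2): *Let `F` be an
imaginary quadratic field such that the Mordell–Weil group `X₀(15)(F)` is finite. Then every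
elliptic curve `E/F` is modular.* [CaraianiNewton2023]

## Status of the discharge `CaraianiNewton2023_modularity_holds` (triage 2026-08-15: XL)

The printed proof of Cor. 7.1.2 (p. 93 of the arXiv v3 text) is: Thm. 7.1 (modularity of `E/F`,
`F` imaginary quadratic, when `E[5]` is irreducible, or `E[3]` is irreducible with image not the
normaliser of a split Cartan) reduces everything to the `F`-points of `X₀(15) = X(b3, b5)` and of
the isogenous `X(s3, b5)` (15A3); finiteness of `X₀(15)(F)`, Kwon's classification of torsion
growth in quadratic fields [Kwo97, Thm. 1] (`X₀(15)(F)_tors = X₀(15)(ℚ) ≅ ℤ/2 × ℤ/4` unless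
`F = ℚ(√-1), ℚ(√5)`), and a Faltings–Serre verification for one curve over `ℚ(√-1)` (LMFDB
4050.1-c3) finish. Thm. 7.1 in turn is Cor. 6.1.1 (Thm. 6.1 + the Goursat/Dickson Lemma 6.2.2:
`ρ̄_{E,p}|_{G_{F(ζ_p)}}` absolutely irreducible ⇒ decomposed generic, `p ∈ {3, 5}`) plus the
analysis of quadratic points on `X(ns3°, b5)`, `X(b3, ns5)`, `X(ns3°, ns5)`, `X(s3, ns5)` (§§7.2–7.4,
Magma); and Thm. 6.1 is the ordinary / potentially Barsotti–Tate automorphy lifting Thm. 5.2 of the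
paper (resting on `P`-ordinary Hida theory for completed cohomology, §2, and the crystalline
local–global compatibility Thm. 4.2.15 for the Galois determinants attached to torsion classes,
§4) combined with the residual modularity propositions of Allen–Khare–Thorne [AKT23, Props. 9.12,
9.13, 9.15] (Props. 6.1.5/6.1.6), Lemma 6.1.3 (Varma's local–global compatibility) and solvable
descent [ACC⁺18, Prop. 6.5.13]. None of these results has a carrier in Mathlib or `Literature`
(the tree's `CompletedCohomologyHeckeAlgebraGLn` builds the big Hecke algebra but records Scholze's
Galois determinants only as named facts, for totally real base fields), and D-0026 forbids minting
them as new named facts from this seat; so the discharge is out of inline reach today and the named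
fact stays a fact. What *is* checkable now is the one modelling choice in the **hypothesis** of the
rendering — that the printed Legendre equation `y² = x(x + 16)(x + 25)` (`X0FifteenLegendre`) is a
`ℚ`-model of `X₀(15)`, i.e. is `ℚ`-isomorphic to the curve 15A1 of Cremona's tables
(`X₀(15) = X(b3, b5) ≅` 15A1 is the source's identification, §7 and [FLHS15, Lemma 5.6]) — and
that is what this file proves, so that `Finite (X0FifteenLegendre ⊗ F)(F)` is, up to a
`ℚ`-isomorphism of Weierstrass models (which induces a bijection on `F`-points), the printed
hypothesis "`X₀(15)(F)` is finite".

## Contents (all proved; elementary arithmetic of Weierstrass models, [folklore])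

* `variableChange_X0FifteenLegendre_eq_cremona15a1` : the admissible change of variables
  `(u, r, s, t) = (2, -12, 1, 4)`, i.e. `x = 4x' - 12`, `y = 8y' + 4x' + 4`, carries
  `X0FifteenLegendre : y² = x³ + 41x² + 400x` to the reduced minimal model
  `y² + xy + y = x³ + x² - 10x - 10`, `[a₁, a₂, a₃, a₄, a₆] = [1, 1, 1, -10, -10]`, which is the
  equation of the curve 15A1 in Cremona's *Algorithms for Modular Elliptic Curves*, Table 1
  (LMFDB label 15.a5).
* `cremona15a1_variableChange_eq_X0FifteenLegendre` : the inverse change `(1/2, 3, -1/2, -2)`.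
* `cremona15a1_Δ` : that model has `Δ = 50625 = 3⁴ · 5⁴` (so `2¹² · 50625 = 207360000 = Δ` of the
  Legendre model, `X0FifteenLegendre_Δ`, as `variableChange_Δ` predicts with `u = 2`).
* `X0FifteenLegendre_c₄`, `X0FifteenLegendre_j` : `c₄ = 7696 = 2⁴ · 481` and
  `j(X₀(15)) = 481³ / (3⁴ · 5⁴) = 111284641 / 50625`.
* **The rational torsion `ℤ/4 × ℤ/2` of `X₀(15)` on the Legendre model** (source, proof of
  Cor. 7.1.2: "We have `X₀(15)(ℚ) ≅ ℤ/2ℤ × ℤ/4ℤ`"; Cremona's Table 1 lists 15A1 with `|T| = 8`).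
  With `P = (-20, 20)` and `Q = (-16, 0)` the eight points `{aP + bQ}` are
  `O, P, 2P = (0, 0), 3P = (-20, -20), Q, P + Q = (20, 180), 2P + Q = (-25, 0),
  3P + Q = (20, -180)` (Mathlib's affine group law `WeierstrassCurve.Affine.Point`, computed from
  the chord–tangent formulae `addX`/`addY`/`slope`): `X0FifteenLegendre_nonsingular_iff`
  (`(x, y)` is a point iff `y² = x³ + 41x² + 400x`), the seven `…_nonsingular_…` lemmas,
  `X0FifteenLegendre_P_add_P`, `…_twoP_add_P`, `…_neg_P`, `…_P_add_Q`, `…_twoP_add_Q`,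
  `…_threeP_add_Q`, `…_twoP_add_twoP`, `…_Q_add_Q`, the orders `X0FifteenLegendre_addOrderOf_P :
  addOrderOf P = 4`, `X0FifteenLegendre_addOrderOf_Q : addOrderOf Q = 2`,
  `X0FifteenLegendre_Q_not_mem_zmultiples_P : Q ∉ ⟨P⟩`, and the embedding
  `X0FifteenLegendre_exists_zmod4_prod_zmod2_injective : ∃ f : ℤ/4 × ℤ/2 →+ X₀(15)(ℚ)` injective
  with `f(1,0) = P`, `f(0,1) = Q`. (That these eight points are *all* of `X₀(15)(ℚ)` — rank `0`
  and no further torsion — is a `2`-descent, not done here; the source takes it from Cremona /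
  the LMFDB.)

* **The second curve of the proof of Cor. 7.1.2, `X(s3, b5) = 15A3`** (section `TorsionXs3b5`):
  the printed Legendre form `y² = x(x + 1)(x + 16)` (the literal model `⟨0, 17, 0, 16, 0⟩`) is
  `ℚ`-isomorphic to Cremona's 15A3 `[1, 1, 1, -5, 2]` (`Δ = 225`) by `(u, r, s, t) = (2, -4, 1, 4)`
  (`variableChange_Xs3b5Legendre_eq_cremona15a3`, `cremona15a3_variableChange_eq_Xs3b5Legendre`,
  `cremona15a3_Δ`, `Xs3b5Legendre_Δ`, `Xs3b5Legendre_c₄`), and `ℤ/4 × ℤ/2 ↪ X(s3, b5)(ℚ)` via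
  `P = (4, 20)` (order `4`) and `Q = (-1, 0)` (order `2`) (`Xs3b5Legendre_P_add_P`, `…_P_add_Q`,
  `…_addOrderOf_P`, `…_addOrderOf_Q`, `Xs3b5Legendre_Q_not_mem_zmultiples_P`,
  `Xs3b5Legendre_exists_zmod4_prod_zmod2_injective`) — the source's "We also have
  `X(s3, b5)(ℚ) ≅ ℤ/2ℤ × ℤ/4ℤ`", lower-bound half.

* **The explicit algebra of §7 (small modular curves; section `SmallModularCurves` below, with its
  own summary).** The source reduces Thm. 7.1 to quadratic points on `X(ns3°, b5)`, `X(b3, ns5)`,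
  `X(ns3°, ns5)`, `X(s3, ns5)` and treats them from explicit equations found with Magma. Certified
  here as identities of polynomials / rational functions over a field: Prop. 7.1.3 (5) — the
  singular model `x³(y² + y - 1)⁵ = 5³y(2y + 1)³(2y² + 7y + 8)³` of `X(ns3, ns5)` is birational to
  `v² - v = t³ + 1` (225A1) by the explicit mutually inverse maps
  `Φ(x, y) = (-x(y² + y - 1)²/(5y(2y + 1)(2y² + 7y + 8)), 1/y)`,
  `Ψ(t, v) = (-5t(v + 2)(8v² + 7v + 2)/(v² - v - 1)², 1/v)` (`Xns3ns5_singularModel_cubeRoot`,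
  `Xns3ns5_singularModel_to_weierstrass`, `Xns3ns5_weierstrass_to_singularModel`,
  `Xns3ns5_singularModel_roundtrip`, `Xns3ns5_weierstrass_roundtrip`,
  `variableChange_Xns3ns5_weierstrass_eq_cremona225a1`, `cremona225a1_Δ = -675`,
  `cremona225a1_c₄ = 0`);
  Prop. 7.2.1 — the parametrisation of `X(ns3, b5)` with `j = (t⁶ + 250t³ + 5⁵)³/t¹⁵`, the printed
  factorisation of `(t⁶ + 250t³ + 5⁵)³ - 1728t¹⁵`, `x³ = 1728 ↔ x = 12` over `ℚ`, the fibre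
  `432d = 12²·3d`, and the lift `(x, y) ↦ (5/x, 5y/x²)` of `w₅` to `C : y² = -3(x⁴ + 2x³ - x² + 10x
  + 25)` (`Xns3b5_parametrisation`, `Xns3b5_j_sub_1728_factorisation`, `Xns3_j_eq_1728_iff`,
  `Xns3o_fibre_at_twelve`, `Cns3ob5_w5`); Prop. 7.2.2 — `C(ℚ) = ∅` and the two pointless conics,
  which the source checks `3`-adically and which already fail over `ℝ`
  (`x⁴ + 2x³ - x² + 10x + 25 = (x² + x - 3)² + 4(x + 2)² > 0`; `Cns3ob5_quartic_pos`,
  `Cns3ob5_no_real_points`, `Cns3ob5_no_real_points_at_infinity`, `Cns3ob5_conic_E₁_no_points`,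
  `Cns3ob5_conic_E₂_no_points`, `Cns3ob5_conic_E₀_point`); and the printed points of `C` over
  `ℚ(√-3)` and the solution of eq. (7.2.1) (`Cns3ob5_points`, `Cns3ob5_eq721_solution`).
  Section `SmallModularCurvesII`: Prop. 7.3.1 — the sextic of `X(b3, ns5)` is
  `(x + 1)(x - 2)(3x - 1)(3x³ + 2x² - 4x - 4)` with the cubic irreducible over `ℚ`
  (`Xb3ns5_sextic_factorisation`, `Xb3ns5_cubic_no_rat_root`, `Xb3ns5_cubic_irreducible`) and the
  `ℚ(√-11)`-points of Prop. 7.3.3 lie on the model (`Xb3ns5_points`);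
  Prop. 7.4.3 — the printed involutions `w₁`, `w₂` preserve the plane quartics `C₁`, `C₂`
  (`Xns3ons5_quartic_w1`, `Xs3ns5_w2_matrix_sq`, `Xs3ns5_quartic_w2_homogeneous`,
  `Xs3ns5_quartic_w2`, `Xs3ns5_w2_involutive`) and `P₁, P₂ ∈ C₂(ℚ(√-55))`
  (`Xs3ns5_quartic_points`); Lemma 7.1.1 / Prop. 7.2.1 — `C_ns(3) ∩ SL₂(𝔽₃) = {±1, ±w}` with
  `w² = -1` normalising the diagonal Cartan, and no element of `C_ns(3)` is conjugate to
  `diag(1, -1)` (`Cns3_det_eq_one_iff`, `Cns3_w_sq`, `Cns3_w_mul_diagonal`, `Cns3_not_isConj_diag`).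

No new definitions and no new named facts (D-0026): the Cremona model is written as the literal
`⟨1, 1, 1, -10, -10⟩ : WeierstrassCurve ℚ`, and the points as literal `Point.some x y h` terms;
the curves of §7 likewise appear only through their printed equations.

## References

* A. Caraiani, J. Newton, *On the modularity of elliptic curves over imaginary quadratic fields*,
  arXiv:2301.10509v3 (2025): Thm. 1.1, §6 (Thm. 6.1, Cor. 6.1.1, Lemma 6.2.2), §7 (Thm. 7.1,
  Lemma 7.1.1, Cor. 7.1.2 and its proof, p. 93: "`X₀(15) = X(b3, b5)` … Cremona label 15A1 …
  A Legendre form for `X₀(15)/ℚ` is `y² = x(x + 16)(x + 25)`"; Prop. 7.1.3 and its proof, p. 94;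
  §7.2: Prop. 7.2.1 and its proof, the points of `C` over `ℚ(√-3)`, Prop. 7.2.2 and its proof with
  eqs. (7.2.1)–(7.2.3), Remark 7.2.3, pp. 94–96; §7.3: Prop. 7.3.1 and its proof, p. 97, and
  Prop. 7.3.3, p. 98; §7.4: Prop. 7.4.3, p. 100; proof of Lemma 7.1.1, p. 92). [CaraianiNewton2023]
* J. E. Cremona, *Algorithms for Modular Elliptic Curves*, 2nd ed. (1997), Table 1, curve 15A1
  `[1, 1, 1, -10, -10]`, `r = 0`, `|T| = 8`. [folklore]
* J. H. Silverman, *The Arithmetic of Elliptic Curves*, 2nd ed. (2009), III.1 (admissible changes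
  of variables, Table 3.1) and III.2 (Group Law Algorithm 2.3). [SilvermanAEC2009]
-/

noncomputable section

namespace Literature.NumberTheory.Automorphic

/-! ### `X0FifteenLegendre` is `ℚ`-isomorphic to Cremona's 15A1 -/

/-- **The Legendre model of `X₀(15)` is `ℚ`-isomorphic to 15A1.** The admissible change of
variables `(u, r, s, t) = (2, -12, 1, 4)` (Silverman, *AEC*, III.1: `x = u²x' + r`,
`y = u³y' + u²sx' + t`, here `x = 4x' - 12`, `y = 8y' + 4x' + 4`) transforms the printed Legendre
equation `y² = x(x + 16)(x + 25)` of Caraiani–Newton, §7, into the reduced minimal Weierstrass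
model `y² + xy + y = x³ + x² - 10x - 10` (`[1, 1, 1, -10, -10]`) of the elliptic curve 15A1 of
Cremona's table, the curve the source identifies with `X₀(15) = X(b3, b5)` ([FLHS15, Lemma 5.6]
as cited there). Hence the hypothesis `Finite (X0FifteenLegendre ⊗ F)(F)` of
`CaraianiNewton2023_modularity` concerns a `ℚ`-isomorphic model of `X₀(15)`. [folklore] -/
theorem variableChange_X0FifteenLegendre_eq_cremona15a1 :
    (⟨Units.mk0 2 two_ne_zero, -12, 1, 4⟩ : WeierstrassCurve.VariableChange ℚ) •
        X0FifteenLegendre = (⟨1, 1, 1, -10, -10⟩ : WeierstrassCurve ℚ) := by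
  simp only [X0FifteenLegendre, WeierstrassCurve.variableChange_def, Units.val_inv_eq_inv_val,
    Units.val_mk0, WeierstrassCurve.mk.injEq]
  norm_num

/-- The inverse isomorphism: the change of variables `(u, r, s, t) = (1/2, 3, -1/2, -2)` carries
Cremona's model `[1, 1, 1, -10, -10]` of 15A1 to the Legendre model `y² = x(x + 16)(x + 25)` of
`X₀(15)` printed by Caraiani–Newton, §7. [folklore] -/
theorem cremona15a1_variableChange_eq_X0FifteenLegendre :
    (⟨Units.mk0 2⁻¹ (inv_ne_zero two_ne_zero), 3, -2⁻¹, -2⟩ : WeierstrassCurve.VariableChange ℚ) •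
        (⟨1, 1, 1, -10, -10⟩ : WeierstrassCurve ℚ) = X0FifteenLegendre := by
  simp only [X0FifteenLegendre, WeierstrassCurve.variableChange_def, Units.val_inv_eq_inv_val,
    Units.val_mk0, WeierstrassCurve.mk.injEq]
  norm_num

/-- Cremona's model `[1, 1, 1, -10, -10]` of 15A1 has discriminant `Δ = 50625 = 3⁴ · 5⁴`
(conductor `15`; compare `X0FifteenLegendre_Δ : Δ = 207360000 = 2¹² · 50625`, in accordance with
`WeierstrassCurve.variableChange_Δ` for `u = 2`). [folklore] -/
theorem cremona15a1_Δ : (⟨1, 1, 1, -10, -10⟩ : WeierstrassCurve ℚ).Δ = 50625 := by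
  norm_num [WeierstrassCurve.Δ, WeierstrassCurve.b₂, WeierstrassCurve.b₄, WeierstrassCurve.b₆,
    WeierstrassCurve.b₈]

/-! ### Invariants of the Legendre model -/

/-- The Legendre model of `X₀(15)` has `c₄ = b₂² - 24 b₄ = 164² - 24 · 800 = 7696 = 2⁴ · 481`.
[folklore] -/
theorem X0FifteenLegendre_c₄ : X0FifteenLegendre.c₄ = 7696 := by
  norm_num [X0FifteenLegendre, WeierstrassCurve.c₄, WeierstrassCurve.b₂, WeierstrassCurve.b₄]

/-- **The `j`-invariant of `X₀(15)`**: `j = c₄³ / Δ = 7696³ / 207360000 = 481³ / (3⁴ · 5⁴) =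
111284641 / 50625` (the `j`-invariant of 15A1, LMFDB 15.a5; invariant under the isomorphism
`variableChange_X0FifteenLegendre_eq_cremona15a1`, `WeierstrassCurve.variableChange_j`).
[folklore] -/
theorem X0FifteenLegendre_j : X0FifteenLegendre.j = 111284641 / 50625 := by
  rw [WeierstrassCurve.j, Units.val_inv_eq_inv_val, WeierstrassCurve.coe_Δ', X0FifteenLegendre_Δ,
    X0FifteenLegendre_c₄]
  norm_num

/-! ### The rational torsion `ℤ/4 × ℤ/2` of `X₀(15)` on the Legendre model -/

section Torsion

open WeierstrassCurve WeierstrassCurve.Affine WeierstrassCurve.Affine.Point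

/-- `Δ ≠ 0` for the affine Legendre model (`X0FifteenLegendre_Δ`). [folklore] -/
theorem X0FifteenLegendre_toAffine_Δ_ne_zero : X0FifteenLegendre.toAffine.Δ ≠ 0 := by
  change X0FifteenLegendre.Δ ≠ 0
  rw [X0FifteenLegendre_Δ]
  norm_num

/-- Coefficient `a₁ = 0` of the affine Legendre model (definitional). [folklore] -/
theorem X0FifteenLegendre_toAffine_a₁ : X0FifteenLegendre.toAffine.a₁ = 0 := rfl
/-- Coefficient `a₂ = 41` of the affine Legendre model (definitional). [folklore] -/
theorem X0FifteenLegendre_toAffine_a₂ : X0FifteenLegendre.toAffine.a₂ = 41 := rfl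
/-- Coefficient `a₃ = 0` of the affine Legendre model (definitional). [folklore] -/
theorem X0FifteenLegendre_toAffine_a₃ : X0FifteenLegendre.toAffine.a₃ = 0 := rfl
/-- Coefficient `a₄ = 400` of the affine Legendre model (definitional). [folklore] -/
theorem X0FifteenLegendre_toAffine_a₄ : X0FifteenLegendre.toAffine.a₄ = 400 := rfl
/-- Coefficient `a₆ = 0` of the affine Legendre model (definitional). [folklore] -/
theorem X0FifteenLegendre_toAffine_a₆ : X0FifteenLegendre.toAffine.a₆ = 0 := rfl

/-- **Points of the Legendre model.** `(x, y) ∈ ℚ²` is a (nonsingular) affine point of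
`X0FifteenLegendre` iff `y² = x³ + 41x² + 400x = x(x + 16)(x + 25)` (every point of an elliptic
curve is nonsingular, `equation_iff_nonsingular_of_Δ_ne_zero`). [folklore] -/
theorem X0FifteenLegendre_nonsingular_iff (x y : ℚ) :
    X0FifteenLegendre.toAffine.Nonsingular x y ↔ y ^ 2 = x ^ 3 + 41 * x ^ 2 + 400 * x := by
  rw [← equation_iff_nonsingular_of_Δ_ne_zero X0FifteenLegendre_toAffine_Δ_ne_zero,
    WeierstrassCurve.Affine.equation_iff, X0FifteenLegendre_toAffine_a₁,
    X0FifteenLegendre_toAffine_a₂, X0FifteenLegendre_toAffine_a₃, X0FifteenLegendre_toAffine_a₄,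
    X0FifteenLegendre_toAffine_a₆]
  simp

/-- Negation on the Legendre model is `(x, y) ↦ (x, -y)` (`a₁ = a₃ = 0`). [folklore] -/
theorem X0FifteenLegendre_negY (x y : ℚ) : X0FifteenLegendre.toAffine.negY x y = -y := by
  simp [negY, X0FifteenLegendre_toAffine_a₁, X0FifteenLegendre_toAffine_a₃]

/-- `P = (-20, 20)` is a rational point of `X₀(15)` (Legendre model): `20² = (-20)(-4)(5)`;
it has order `4` (`X0FifteenLegendre_addOrderOf_P`). [folklore] -/
theorem X0FifteenLegendre_nonsingular_P : X0FifteenLegendre.toAffine.Nonsingular (-20) 20 := by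
  rw [X0FifteenLegendre_nonsingular_iff]; norm_num

/-- `Q = (-16, 0)` is a rational point of `X₀(15)` (Legendre model), of order `2`
(`X0FifteenLegendre_addOrderOf_Q`). [folklore] -/
theorem X0FifteenLegendre_nonsingular_Q : X0FifteenLegendre.toAffine.Nonsingular (-16) 0 := by
  rw [X0FifteenLegendre_nonsingular_iff]; norm_num

/-- `2P = (0, 0)` is a rational point of `X₀(15)` (Legendre model), of order `2`. [folklore] -/
theorem X0FifteenLegendre_nonsingular_twoP : X0FifteenLegendre.toAffine.Nonsingular 0 0 := by
  rw [X0FifteenLegendre_nonsingular_iff]; norm_num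

/-- `3P = -P = (-20, -20)` is a rational point of `X₀(15)` (Legendre model). [folklore] -/
theorem X0FifteenLegendre_nonsingular_threeP :
    X0FifteenLegendre.toAffine.Nonsingular (-20) (-20) := by
  rw [X0FifteenLegendre_nonsingular_iff]; norm_num

/-- `P + Q = (20, 180)` is a rational point of `X₀(15)` (Legendre model): `180² = 20 · 36 · 45`.
[folklore] -/
theorem X0FifteenLegendre_nonsingular_PQ : X0FifteenLegendre.toAffine.Nonsingular 20 180 := by
  rw [X0FifteenLegendre_nonsingular_iff]; norm_num

/-- `2P + Q = (-25, 0)` is a rational point of `X₀(15)` (Legendre model), of order `2`.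
[folklore] -/
theorem X0FifteenLegendre_nonsingular_twoPQ : X0FifteenLegendre.toAffine.Nonsingular (-25) 0 := by
  rw [X0FifteenLegendre_nonsingular_iff]; norm_num

/-- `3P + Q = (20, -180)` is a rational point of `X₀(15)` (Legendre model). [folklore] -/
theorem X0FifteenLegendre_nonsingular_threePQ :
    X0FifteenLegendre.toAffine.Nonsingular 20 (-180) := by
  rw [X0FifteenLegendre_nonsingular_iff]; norm_num

/-- **Doubling `P = (-20, 20)`**: tangent slope `λ = (3x² + 82x + 400)/(2y) = -1`, so
`2P = (λ² - 41 - 2x, …) = (0, 0)` (Silverman, *AEC*, III.2.3). [folklore] -/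
theorem X0FifteenLegendre_P_add_P :
    (.some (-20) 20 X0FifteenLegendre_nonsingular_P : X0FifteenLegendre.toAffine.Point) +
      .some (-20) 20 X0FifteenLegendre_nonsingular_P =
        .some 0 0 X0FifteenLegendre_nonsingular_twoP := by
  have hy : (20 : ℚ) ≠ X0FifteenLegendre.toAffine.negY (-20) 20 := by
    rw [X0FifteenLegendre_negY]; norm_num
  rw [add_self_of_Y_ne hy]
  simp only [some.injEq]
  rw [slope_of_Y_ne rfl hy]
  simp only [addX, addY, negAddY, negY, X0FifteenLegendre_toAffine_a₁,
    X0FifteenLegendre_toAffine_a₂, X0FifteenLegendre_toAffine_a₃, X0FifteenLegendre_toAffine_a₄]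
  norm_num

/-- **`P + Q = (20, 180)`** for `P = (-20, 20)`, `Q = (-16, 0)`: chord slope `λ = -5`,
`x = λ² - 41 + 20 + 16 = 20` (Silverman, *AEC*, III.2.3). [folklore] -/
theorem X0FifteenLegendre_P_add_Q :
    (.some (-20) 20 X0FifteenLegendre_nonsingular_P : X0FifteenLegendre.toAffine.Point) +
      .some (-16) 0 X0FifteenLegendre_nonsingular_Q =
        .some 20 180 X0FifteenLegendre_nonsingular_PQ := by
  rw [add_of_X_ne (by norm_num : (-20 : ℚ) ≠ -16)]
  simp only [some.injEq]
  rw [slope_of_X_ne (by norm_num : (-20 : ℚ) ≠ -16)]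
  simp only [addX, addY, negAddY, negY, X0FifteenLegendre_toAffine_a₁,
    X0FifteenLegendre_toAffine_a₂, X0FifteenLegendre_toAffine_a₃]
  norm_num

/-- **`2P + Q = (-25, 0)`**: the sum of the `2`-torsion points `(0, 0)` and `(-16, 0)` is the third
`2`-torsion point (roots `0, -16, -25` of `x(x + 16)(x + 25)`). [folklore] -/
theorem X0FifteenLegendre_twoP_add_Q :
    (.some 0 0 X0FifteenLegendre_nonsingular_twoP : X0FifteenLegendre.toAffine.Point) +
      .some (-16) 0 X0FifteenLegendre_nonsingular_Q =
        .some (-25) 0 X0FifteenLegendre_nonsingular_twoPQ := by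
  rw [add_of_X_ne (by norm_num : (0 : ℚ) ≠ -16)]
  simp only [some.injEq]
  rw [slope_of_X_ne (by norm_num : (0 : ℚ) ≠ -16)]
  simp only [addX, addY, negAddY, negY, X0FifteenLegendre_toAffine_a₁,
    X0FifteenLegendre_toAffine_a₂, X0FifteenLegendre_toAffine_a₃]
  norm_num

/-- **`-P = (-20, -20)`** (`= 3P`, as `4P = O`). [folklore] -/
theorem X0FifteenLegendre_neg_P :
    -(.some (-20) 20 X0FifteenLegendre_nonsingular_P : X0FifteenLegendre.toAffine.Point) =
        .some (-20) (-20) X0FifteenLegendre_nonsingular_threeP := by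
  rw [neg_some]
  simp only [X0FifteenLegendre_negY]

/-- `2 · (0, 0) = O`: `(0, 0)` is `2`-torsion (`y = 0`). [folklore] -/
theorem X0FifteenLegendre_twoP_add_twoP :
    (.some 0 0 X0FifteenLegendre_nonsingular_twoP : X0FifteenLegendre.toAffine.Point) +
      .some 0 0 X0FifteenLegendre_nonsingular_twoP = 0 :=
  add_self_of_Y_eq (by rw [X0FifteenLegendre_negY]; norm_num)

/-- `2Q = O` for `Q = (-16, 0)` (a `2`-torsion point: `y = 0`). [folklore] -/
theorem X0FifteenLegendre_Q_add_Q :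
    (.some (-16) 0 X0FifteenLegendre_nonsingular_Q : X0FifteenLegendre.toAffine.Point) +
      .some (-16) 0 X0FifteenLegendre_nonsingular_Q = 0 :=
  add_self_of_Y_eq (by rw [X0FifteenLegendre_negY]; norm_num)

/-- **`Q = (-16, 0)` has order `2`** in `X₀(15)(ℚ)`. [folklore] -/
theorem X0FifteenLegendre_addOrderOf_Q :
    addOrderOf (.some (-16) 0 X0FifteenLegendre_nonsingular_Q : X0FifteenLegendre.toAffine.Point)
      = 2 := by
  refine addOrderOf_eq_prime ?_ (some_ne_zero _)
  rw [two_nsmul, X0FifteenLegendre_Q_add_Q]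

/-- **`P = (-20, 20)` has order `4`** in `X₀(15)(ℚ)` (`2P = (0,0) ≠ O`, `4P = O`). [folklore] -/
theorem X0FifteenLegendre_addOrderOf_P :
    addOrderOf (.some (-20) 20 X0FifteenLegendre_nonsingular_P : X0FifteenLegendre.toAffine.Point)
      = 4 := by
  have h2 : 2 • (.some (-20) 20 X0FifteenLegendre_nonsingular_P : X0FifteenLegendre.toAffine.Point)
      = .some 0 0 X0FifteenLegendre_nonsingular_twoP := by
    rw [two_nsmul, X0FifteenLegendre_P_add_P]
  have h4 : 4 • (.some (-20) 20 X0FifteenLegendre_nonsingular_P : X0FifteenLegendre.toAffine.Point)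
      = 0 := by
    rw [show (4 : ℕ) = 2 * 2 from rfl, mul_nsmul, h2, two_nsmul, X0FifteenLegendre_twoP_add_twoP]
  have := addOrderOf_eq_prime_pow (p := 2) (n := 1) (x := (.some (-20) 20
    X0FifteenLegendre_nonsingular_P : X0FifteenLegendre.toAffine.Point)) ?_ ?_
  · simpa using this
  · rw [pow_one, h2]; exact some_ne_zero _
  · simpa using h4

/-- **`2P + P = 3P = (-20, -20)`**: chord through `(0, 0)` and `(-20, 20)`, slope `-1`. [folklore] -/
theorem X0FifteenLegendre_twoP_add_P :
    (.some 0 0 X0FifteenLegendre_nonsingular_twoP : X0FifteenLegendre.toAffine.Point) +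
      .some (-20) 20 X0FifteenLegendre_nonsingular_P =
        .some (-20) (-20) X0FifteenLegendre_nonsingular_threeP := by
  rw [add_of_X_ne (by norm_num : (0 : ℚ) ≠ -20)]
  simp only [some.injEq]
  rw [slope_of_X_ne (by norm_num : (0 : ℚ) ≠ -20)]
  simp only [addX, addY, negAddY, negY, X0FifteenLegendre_toAffine_a₁,
    X0FifteenLegendre_toAffine_a₂, X0FifteenLegendre_toAffine_a₃]
  norm_num

/-- **`3P + Q = (20, -180)`**: chord through `3P = (-20, -20)` and `Q = (-16, 0)`, slope `5`.
[folklore] -/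
theorem X0FifteenLegendre_threeP_add_Q :
    (.some (-20) (-20) X0FifteenLegendre_nonsingular_threeP : X0FifteenLegendre.toAffine.Point) +
      .some (-16) 0 X0FifteenLegendre_nonsingular_Q =
        .some 20 (-180) X0FifteenLegendre_nonsingular_threePQ := by
  rw [add_of_X_ne (by norm_num : (-20 : ℚ) ≠ -16)]
  simp only [some.injEq]
  rw [slope_of_X_ne (by norm_num : (-20 : ℚ) ≠ -16)]
  simp only [addX, addY, negAddY, negY, X0FifteenLegendre_toAffine_a₁,
    X0FifteenLegendre_toAffine_a₂, X0FifteenLegendre_toAffine_a₃]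
  norm_num

/-- `2 • P = (0, 0)` (integer multiple). [folklore] -/
theorem X0FifteenLegendre_two_zsmul_P :
    (2 : ℤ) • (.some (-20) 20 X0FifteenLegendre_nonsingular_P : X0FifteenLegendre.toAffine.Point) =
      .some 0 0 X0FifteenLegendre_nonsingular_twoP := by
  rw [two_zsmul, X0FifteenLegendre_P_add_P]

/-- `3 • P = (-20, -20) = -P` (integer multiple). [folklore] -/
theorem X0FifteenLegendre_three_zsmul_P :
    (3 : ℤ) • (.some (-20) 20 X0FifteenLegendre_nonsingular_P : X0FifteenLegendre.toAffine.Point) =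
      .some (-20) (-20) X0FifteenLegendre_nonsingular_threeP := by
  rw [show (3 : ℤ) = 2 + 1 by norm_num, add_zsmul, one_zsmul, X0FifteenLegendre_two_zsmul_P,
    X0FifteenLegendre_twoP_add_P]

/-- `4 • P = O`. [folklore] -/
theorem X0FifteenLegendre_four_zsmul_P :
    (4 : ℤ) • (.some (-20) 20 X0FifteenLegendre_nonsingular_P : X0FifteenLegendre.toAffine.Point) =
      0 := by
  rw [show (4 : ℤ) = 2 + 2 by norm_num, add_zsmul, X0FifteenLegendre_two_zsmul_P,
    X0FifteenLegendre_twoP_add_twoP]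

/-- **`Q ∉ ⟨P⟩`**: the multiples of `P` are `O, (-20, 20), (0, 0), (-20, -20)`, none of which is
`Q = (-16, 0)`; so `⟨P, Q⟩ = ⟨P⟩ ⊕ ⟨Q⟩` has order `8`. [folklore] -/
theorem X0FifteenLegendre_Q_not_mem_zmultiples_P :
    (.some (-16) 0 X0FifteenLegendre_nonsingular_Q : X0FifteenLegendre.toAffine.Point) ∉
      AddSubgroup.zmultiples (.some (-20) 20 X0FifteenLegendre_nonsingular_P) := by
  rw [AddSubgroup.mem_zmultiples_iff]
  rintro ⟨k, hk⟩
  rw [← mod_addOrderOf_zsmul, X0FifteenLegendre_addOrderOf_P] at hk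
  push_cast at hk
  obtain h | h | h | h : k % 4 = 0 ∨ k % 4 = 1 ∨ k % 4 = 2 ∨ k % 4 = 3 := by omega
  · rw [h, zero_zsmul] at hk
    exact some_ne_zero _ hk.symm
  · rw [h, one_zsmul, some.injEq] at hk
    norm_num at hk
  · rw [h, X0FifteenLegendre_two_zsmul_P, some.injEq] at hk
    norm_num at hk
  · rw [h, X0FifteenLegendre_three_zsmul_P, some.injEq] at hk
    norm_num at hk

/-- **`ℤ/4 × ℤ/2 ↪ X₀(15)(ℚ)`.** On the Legendre model `y² = x(x + 16)(x + 25)` printed by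
Caraiani–Newton (§7, proof of Cor. 7.1.2: "We have `X₀(15)(ℚ) ≅ ℤ/2ℤ × ℤ/4ℤ`"), the homomorphism
`ℤ/4 × ℤ/2 → X₀(15)(ℚ)`, `(a, b) ↦ aP + bQ` with `P = (-20, 20)`, `Q = (-16, 0)`, is injective
(`ZMod.lift` of `k ↦ kP`, `k ↦ kQ`; kernel-freeness from `addOrderOf P = 4`, `addOrderOf Q = 2`
and `Q ∉ ⟨P⟩`). This is the lower bound `X₀(15)(ℚ) ⊇ ℤ/2 × ℤ/4` of the printed group
structure; equality (rank `0`, Cremona 15A1: `r = 0`, `|T| = 8`) is a `2`-descent not carried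
out here. [cite: CaraianiNewton2023, §7, proof of Cor. 7.1.2] -/
theorem X0FifteenLegendre_exists_zmod4_prod_zmod2_injective :
    ∃ f : ZMod 4 × ZMod 2 →+ X0FifteenLegendre.toAffine.Point,
      Function.Injective f ∧
        f (1, 0) = .some (-20) 20 X0FifteenLegendre_nonsingular_P ∧
          f (0, 1) = .some (-16) 0 X0FifteenLegendre_nonsingular_Q := by
  set P : X0FifteenLegendre.toAffine.Point := .some (-20) 20 X0FifteenLegendre_nonsingular_P
    with hPdef
  set Q : X0FifteenLegendre.toAffine.Point := .some (-16) 0 X0FifteenLegendre_nonsingular_Q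
    with hQdef
  have hP4 : (zmultiplesHom _ P : ℤ →+ _) (4 : ℕ) = 0 := by
    simpa using X0FifteenLegendre_four_zsmul_P
  have hQ2 : (zmultiplesHom _ Q : ℤ →+ _) (2 : ℕ) = 0 := by
    simpa [two_zsmul] using X0FifteenLegendre_Q_add_Q
  let fP : ZMod 4 →+ X0FifteenLegendre.toAffine.Point := ZMod.lift 4 ⟨zmultiplesHom _ P, hP4⟩
  let fQ : ZMod 2 →+ X0FifteenLegendre.toAffine.Point := ZMod.lift 2 ⟨zmultiplesHom _ Q, hQ2⟩
  have hfP : ∀ k : ℤ, fP k = k • P := fun k ↦ by simp [fP]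
  have hfQ : ∀ k : ℤ, fQ k = k • Q := fun k ↦ by simp [fQ]
  refine ⟨fP.coprod fQ, ?_, ?_, ?_⟩
  · rw [injective_iff_map_eq_zero]
    rintro ⟨a, b⟩ hab
    rw [AddMonoidHom.coprod_apply] at hab
    obtain ⟨a, rfl⟩ := ZMod.intCast_surjective a
    obtain ⟨b, rfl⟩ := ZMod.intCast_surjective b
    rw [hfP, hfQ, ← mod_addOrderOf_zsmul Q, X0FifteenLegendre_addOrderOf_Q] at hab
    push_cast at hab
    obtain hb | hb : b % 2 = 0 ∨ b % 2 = 1 := by omega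
    · rw [hb, zero_zsmul, add_zero] at hab
      have ha : (4 : ℤ) ∣ a := by
        have := addOrderOf_dvd_iff_zsmul_eq_zero.2 hab
        rwa [X0FifteenLegendre_addOrderOf_P] at this
      refine Prod.ext ?_ ?_
      · simpa [ZMod.intCast_zmod_eq_zero_iff_dvd] using ha
      · have : (2 : ℤ) ∣ b := by omega
        simpa [ZMod.intCast_zmod_eq_zero_iff_dvd] using this
    · exfalso
      rw [hb, one_zsmul, add_eq_zero_iff_eq_neg, hQdef, neg_some] at hab
      simp only [X0FifteenLegendre_negY, _root_.neg_zero] at hab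
      exact X0FifteenLegendre_Q_not_mem_zmultiples_P ⟨a, hab⟩
  · have h1 := hfP 1
    rw [Int.cast_one, one_zsmul] at h1
    simpa only [AddMonoidHom.coprod_apply, _root_.map_zero, add_zero] using h1
  · have h1 := hfQ 1
    rw [Int.cast_one, one_zsmul] at h1
    simpa only [AddMonoidHom.coprod_apply, _root_.map_zero, zero_add] using h1

end Torsion

/-! ## §7 of the source: the explicit computations with small modular curves

Caraiani–Newton, §7 (pp. 93–100 of the arXiv v3 text) reduces Thm. 7.1 — via Thm. 6.1 and the
group theory of Lemma 7.1.1 — to the modularity of the elliptic curves underlying the quadratic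
points of the four modular curves `X(ns3°, b5)`, `X(b3, ns5)`, `X(ns3°, ns5)`, `X(s3, ns5)`, and
analyses those points from explicit equations ("We used Magma to do the computations", p. 94).
The theorems of this section certify, as identities of polynomials / rational functions, the
explicit algebra printed there that does not depend on the moduli interpretation:

* **Prop. 7.1.3 (5)** (p. 94): from the printed `j`-maps of `X(ns3)` (`j = x³`, part (3)) and
  `X(ns5)` (`j = 5³y(2y+1)³(2y²+7y+8)³/(y²+y-1)⁵`, part (4)), "a singular model for `X(ns3, ns5)`
  is given by the equation `x³ = 5³y(2y+1)³(2y²+7y+8)³/(y²+y-1)⁵`. Some simple manipulations show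
  that this is birational to the elliptic curve `y² - y = x³ + 1`, which has Cremona label 225A1
  as claimed. This is also checked in the Magma file ns3ns5-elliptic.m." We make the simple
  manipulations explicit: `u = x(y²+y-1)²/(5(2y+1)(2y²+7y+8))` has `u³ = y³ + y² - y`
  (`Xns3ns5_singularModel_cubeRoot`), and `(t, v) = (-u/y, 1/y)` satisfies `v² - v = t³ + 1`;
  the maps `Φ(x, y) = (-x(y²+y-1)²/(5y(2y+1)(2y²+7y+8)), 1/y)` and
  `Ψ(t, v) = (-5t(v+2)(8v²+7v+2)/(v²-v-1)², 1/v)` are mutually inverse rational maps between the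
  singular model and `v² - v = t³ + 1` (`Xns3ns5_singularModel_to_weierstrass`,
  `Xns3ns5_weierstrass_to_singularModel`, `Xns3ns5_singularModel_roundtrip`,
  `Xns3ns5_weierstrass_roundtrip`), and `v² - v = t³ + 1` is the Weierstrass curve
  `⟨0, 0, -1, 0, 1⟩`, carried by `u = -1` to `[0, 0, 1, 0, 1]` : `y² + y = x³ + 1` (225A1),
  `Δ = -675 = -3³ · 5²`, `c₄ = 0` (so `j = 0`).
* **Prop. 7.2.1** (pp. 94–95): the fibre product `X(ns3, b5) = X(ns3) ×_{X(1)} X(b5)`, i.e.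
  `x³ = (y² + 250y + 5⁵)³/y⁵` (parts (2), (3) of Prop. 7.1.3), is parametrised by
  `x = (t⁶ + 250t³ + 5⁵)/t⁵`, `y = t³`, with `j = (t⁶ + 250t³ + 5⁵)³/t¹⁵` and `w₅ : y ↦ 5³/y`
  becoming `t ↦ 5/t` (`Xns3b5_parametrisation`); the printed factorisation of
  `(t⁶ + 250t³ + 5⁵)³ - 1728t¹⁵` cutting out the fibre at `j = 1728`
  (`Xns3b5_j_sub_1728_factorisation`); "the unique rational point of `X(ns3)` with `j`-invariant
  `1728` is `x = 12`" (`Xns3_j_eq_1728_iff`) and the fibre `y² = d(12² + 12·12 + 144) = 432d`,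
  `432 = 12² · 3` (`Xns3o_fibre_at_twelve`); and part (2), `w₅ : x ↦ 5/x` on the model
  `C : y² = -3(x⁴ + 2x³ - x² + 10x + 25)` — `(x, y) ↦ (5/x, 5y/x²)` preserves `C` (`Cns3ob5_w5`).
* **Prop. 7.2.2 and `C(ℚ) = ∅`** (pp. 95–96): the source checks `C(ℚ) = ∅` and the insolubility
  of the two conics `α₀² + 3α₁² + 6α₁ + 15 = 0`, `α₀² + 3α₁² + 6α₁ + 12 = 0` `3`-adically; all three
  already fail over `ℝ`: `x⁴ + 2x³ - x² + 10x + 25 = (x² + x - 3)² + 4(x + 2)² > 0`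
  (`Cns3ob5_quartic_eq_sos`, `Cns3ob5_quartic_pos`), so `y² = -3(…)` has no solution in a linearly
  ordered field, neither affine nor at infinity (`Cns3ob5_no_real_points`,
  `Cns3ob5_no_real_points_at_infinity`), and `α₀² + 3(α₁ + 1)² + 12 > 0`,
  `α₀² + 3(α₁ + 1)² + 9 > 0` (`Cns3ob5_conic_E₁_no_points`, `Cns3ob5_conic_E₂_no_points`); the
  rational point `(3, 2)` of the conic of `E₀` (Remark 7.2.3, `Cns3ob5_conic_E₀_point`).
* The points `0₊ = (0, 5√-3)`, `P₁ = (-2, -√-3)`, `P₂ = (-5/2, 5√-3/4)`, `∞± = (1 : ±√-3 : 0)` of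
  `C` over `ℚ(√-3)` (p. 95, `Cns3ob5_points`) and the solution `x = 1 + 2i`, `α = 3 + 2√-3` of
  equation (7.2.1) with the point `P = (1 + 2i, 3 + 6i)` of `C` and `x(P)x(σ(P)) = 5` (p. 96,
  `Cns3ob5_eq721_solution`), over any field containing square roots `s` of `-3` and `i` of `-1`.

Not certified here (they need Jacobians, `2`-descents, Chabauty, or the moduli interpretation):
Prop. 7.1.3 (1)–(4), (6) and the `j`-maps themselves, Prop. 7.2.1 (3), Prop. 7.2.2, Prop. 7.2.4,
Cor. 7.2.5, and §§7.3–7.4. [cite: CaraianiNewton2023, §7.1–§7.2]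
-/

section SmallModularCurves

variable {K : Type*} [Field K]

/-! ### Prop. 7.1.3 (5): the singular model of `X(ns3, ns5)` is birational to 225A1 -/

/-- **The cube root.** On the singular model `x³(y² + y - 1)⁵ = 5³y(2y + 1)³(2y² + 7y + 8)³` of
`X(ns3, ns5)` (Caraiani–Newton, proof of Prop. 7.1.3 (5), denominators cleared), the function
`u = x(y² + y - 1)²/(5(2y + 1)(2y² + 7y + 8))` satisfies `u³ = y³ + y² - y`.
[cite: CaraianiNewton2023, Prop. 7.1.3 (5)] -/
theorem Xns3ns5_singularModel_cubeRoot [CharZero K] {x y : K}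
    (h : x ^ 3 * (y ^ 2 + y - 1) ^ 5 =
      5 ^ 3 * y * (2 * y + 1) ^ 3 * (2 * y ^ 2 + 7 * y + 8) ^ 3)
    (h₁ : 2 * y + 1 ≠ 0) (h₂ : 2 * y ^ 2 + 7 * y + 8 ≠ 0) :
    (x * (y ^ 2 + y - 1) ^ 2 / (5 * (2 * y + 1) * (2 * y ^ 2 + 7 * y + 8))) ^ 3 =
      y ^ 3 + y ^ 2 - y := by
  have hD : 5 * (2 * y + 1) * (2 * y ^ 2 + 7 * y + 8) ≠ 0 :=
    mul_ne_zero (mul_ne_zero (by norm_num) h₁) h₂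
  rw [div_pow, div_eq_iff (pow_ne_zero 3 hD)]
  linear_combination (y ^ 2 + y - 1) * h

/-- **Prop. 7.1.3 (5), the map `Φ`.** If `(x, y)` lies on the singular model
`x³(y² + y - 1)⁵ = 5³y(2y + 1)³(2y² + 7y + 8)³` of `X(ns3, ns5)` with `y(2y + 1)(2y² + 7y + 8) ≠ 0`,
then `(t, v) = Φ(x, y) := (-x(y² + y - 1)²/(5y(2y + 1)(2y² + 7y + 8)), 1/y)` lies on the elliptic
curve `v² - v = t³ + 1` ("some simple manipulations show that this is birational to the elliptic
curve `y² - y = x³ + 1`"; with `u` as in `Xns3ns5_singularModel_cubeRoot`, `t = -u/y` and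
`t³ = -(y³ + y² - y)/y³ = v² - v - 1`). [cite: CaraianiNewton2023, Prop. 7.1.3 (5)] -/
theorem Xns3ns5_singularModel_to_weierstrass [CharZero K] {x y t v : K}
    (h : x ^ 3 * (y ^ 2 + y - 1) ^ 5 =
      5 ^ 3 * y * (2 * y + 1) ^ 3 * (2 * y ^ 2 + 7 * y + 8) ^ 3)
    (hy : y ≠ 0) (h₁ : 2 * y + 1 ≠ 0) (h₂ : 2 * y ^ 2 + 7 * y + 8 ≠ 0)
    (ht : t = -(x * (y ^ 2 + y - 1) ^ 2) / (5 * y * (2 * y + 1) * (2 * y ^ 2 + 7 * y + 8)))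
    (hv : v = 1 / y) :
    v ^ 2 - v = t ^ 3 + 1 := by
  set A := 2 * y + 1 with hA
  set B := 2 * y ^ 2 + 7 * y + 8 with hB
  set Q := y ^ 2 + y - 1 with hQ
  have hD : 5 * y * A * B ≠ 0 :=
    mul_ne_zero (mul_ne_zero (mul_ne_zero (by norm_num) hy) h₁) h₂
  have ht₁ : t * (5 * y * A * B) = -(x * Q ^ 2) := by
    rw [ht]
    exact div_mul_cancel₀ _ hD
  have ht₃ : t ^ 3 * (5 * y * A * B) ^ 3 = -(x ^ 3 * Q ^ 6) := by
    rw [← mul_pow, ht₁]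
    ring
  have key : (t ^ 3 * y ^ 2 + Q) * (5 * y * A * B) ^ 3 = 0 := by
    linear_combination y ^ 2 * ht₃ - y ^ 2 * Q * h
  have hq : t ^ 3 * y ^ 2 + Q = 0 := (mul_eq_zero.1 key).resolve_right (pow_ne_zero 3 hD)
  subst hv
  field_simp
  rw [hQ] at hq
  linear_combination (-1 : K) * hq

/-- **Prop. 7.1.3 (5), the inverse map `Ψ`.** If `(t, v)` lies on `v² - v = t³ + 1` with
`v(v² - v - 1) ≠ 0`, then `(x, y) = Ψ(t, v) := (-5t(v + 2)(8v² + 7v + 2)/(v² - v - 1)², 1/v)` lies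
on the singular model `x³(y² + y - 1)⁵ = 5³y(2y + 1)³(2y² + 7y + 8)³` of `X(ns3, ns5)` (here
`t³ = v² - v - 1`, `y² + y - 1 = -(v² - v - 1)/v²`, `2y + 1 = (v + 2)/v`,
`2y² + 7y + 8 = (8v² + 7v + 2)/v²`). [cite: CaraianiNewton2023, Prop. 7.1.3 (5)] -/
theorem Xns3ns5_weierstrass_to_singularModel [CharZero K] {x y t v : K}
    (h : v ^ 2 - v = t ^ 3 + 1) (hv : v ≠ 0) (hq : v ^ 2 - v - 1 ≠ 0)
    (hx : x = -(5 * t * (v + 2) * (8 * v ^ 2 + 7 * v + 2)) / (v ^ 2 - v - 1) ^ 2)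
    (hy : y = 1 / v) :
    x ^ 3 * (y ^ 2 + y - 1) ^ 5 =
      5 ^ 3 * y * (2 * y + 1) ^ 3 * (2 * y ^ 2 + 7 * y + 8) ^ 3 := by
  have ht : t ^ 3 = v ^ 2 - v - 1 := by linear_combination (-1 : K) * h
  set q := v ^ 2 - v - 1 with hq_def
  subst hx hy
  have e₁ : (1 / v) ^ 2 + 1 / v - 1 = -q / v ^ 2 := by
    rw [hq_def]
    field_simp
    ring
  have e₂ : 2 * (1 / v) + 1 = (v + 2) / v := by
    field_simp
    ring
  have e₃ : 2 * (1 / v) ^ 2 + 7 * (1 / v) + 8 = (8 * v ^ 2 + 7 * v + 2) / v ^ 2 := by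
    field_simp
    ring
  rw [e₁, e₂, e₃]
  field_simp
  linear_combination (v + 2) ^ 3 * (8 * v ^ 2 + 7 * v + 2) ^ 3 * ht

/-- **`Ψ ∘ Φ = id`** on the singular model of `X(ns3, ns5)` away from
`y(2y + 1)(2y² + 7y + 8)(y² + y - 1) = 0` (no curve equation needed): with
`(t, v) = Φ(x, y)`, `Ψ(t, v) = (x, y)`. [cite: CaraianiNewton2023, Prop. 7.1.3 (5)] -/
theorem Xns3ns5_singularModel_roundtrip [CharZero K] {x y t v : K}
    (hy : y ≠ 0) (h₁ : 2 * y + 1 ≠ 0) (h₂ : 2 * y ^ 2 + 7 * y + 8 ≠ 0) (h₃ : y ^ 2 + y - 1 ≠ 0)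
    (ht : t = -(x * (y ^ 2 + y - 1) ^ 2) / (5 * y * (2 * y + 1) * (2 * y ^ 2 + 7 * y + 8)))
    (hv : v = 1 / y) :
    -(5 * t * (v + 2) * (8 * v ^ 2 + 7 * v + 2)) / (v ^ 2 - v - 1) ^ 2 = x ∧ 1 / v = y := by
  set A := 2 * y + 1 with hA
  set B := 2 * y ^ 2 + 7 * y + 8 with hB
  set Q := y ^ 2 + y - 1 with hQ
  subst ht hv
  have e₁ : 1 / y + 2 = A / y := by
    rw [hA]
    field_simp
    ring
  have e₂ : 8 * (1 / y) ^ 2 + 7 * (1 / y) + 2 = B / y ^ 2 := by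
    rw [hB]
    field_simp
    ring
  have e₃ : (1 / y) ^ 2 - 1 / y - 1 = -Q / y ^ 2 := by
    rw [hQ]
    field_simp
    ring
  rw [e₁, e₂, e₃]
  constructor <;> field_simp

/-- **`Φ ∘ Ψ = id`** on `v² - v = t³ + 1` away from `v(v² - v - 1)(v + 2)(8v² + 7v + 2) = 0` (no
curve equation needed): with `(x, y) = Ψ(t, v)`, `Φ(x, y) = (t, v)`. Together with the three
previous theorems: the singular model of `X(ns3, ns5)` and the curve `v² - v = t³ + 1` (225A1)
are birational over `ℚ`, as printed. [cite: CaraianiNewton2023, Prop. 7.1.3 (5)] -/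
theorem Xns3ns5_weierstrass_roundtrip [CharZero K] {x y t v : K}
    (hv : v ≠ 0) (hq : v ^ 2 - v - 1 ≠ 0) (h₁ : v + 2 ≠ 0) (h₂ : 8 * v ^ 2 + 7 * v + 2 ≠ 0)
    (hx : x = -(5 * t * (v + 2) * (8 * v ^ 2 + 7 * v + 2)) / (v ^ 2 - v - 1) ^ 2)
    (hy : y = 1 / v) :
    -(x * (y ^ 2 + y - 1) ^ 2) / (5 * y * (2 * y + 1) * (2 * y ^ 2 + 7 * y + 8)) = t ∧
      1 / y = v := by
  set P := v + 2 with hP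
  set R := 8 * v ^ 2 + 7 * v + 2 with hR
  set q := v ^ 2 - v - 1 with hq_def
  subst hx hy
  have e₁ : (1 / v) ^ 2 + 1 / v - 1 = -q / v ^ 2 := by
    rw [hq_def]
    field_simp
    ring
  have e₂ : 2 * (1 / v) + 1 = P / v := by
    rw [hP]
    field_simp
    ring
  have e₃ : 2 * (1 / v) ^ 2 + 7 * (1 / v) + 8 = R / v ^ 2 := by
    rw [hR]
    field_simp
    ring
  rw [e₁, e₂, e₃]
  constructor <;> field_simp

/-- The curve `v² - v = t³ + 1` of Prop. 7.1.3 (5) is the Weierstrass curve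
`[a₁, a₂, a₃, a₄, a₆] = [0, 0, -1, 0, 1]`: its affine equation is `v² - v = t³ + 1`. [folklore] -/
theorem Xns3ns5_weierstrass_equation_iff (t v : ℚ) :
    (⟨0, 0, -1, 0, 1⟩ : WeierstrassCurve ℚ).toAffine.Equation t v ↔ v ^ 2 - v = t ^ 3 + 1 := by
  rw [WeierstrassCurve.Affine.equation_iff]
  change v ^ 2 + 0 * t * v + (-1) * v = t ^ 3 + 0 * t ^ 2 + 0 * t + 1 ↔ _
  constructor <;> intro h <;> linear_combination h

/-- The change of variables `u = -1` (`y ↦ -y`) carries `[0, 0, -1, 0, 1]` (`v² - v = t³ + 1`, the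
form printed in Prop. 7.1.3 (5)) to `[0, 0, 1, 0, 1]` : `y² + y = x³ + 1`, the curve of conductor
`225 = 3² · 5²` which the source identifies as Cremona's 225A1 (`X(ns3, ns5)(ℚ) ≅ ℤ`).
[cite: CaraianiNewton2023, Prop. 7.1.3 (5)] -/
theorem variableChange_Xns3ns5_weierstrass_eq_cremona225a1 :
    (⟨-1, 0, 0, 0⟩ : WeierstrassCurve.VariableChange ℚ) •
        (⟨0, 0, -1, 0, 1⟩ : WeierstrassCurve ℚ) = (⟨0, 0, 1, 0, 1⟩ : WeierstrassCurve ℚ) := by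
  simp only [WeierstrassCurve.variableChange_def, Units.val_inv_eq_inv_val,
    WeierstrassCurve.mk.injEq]
  norm_num

/-- `y² + y = x³ + 1` (`[0, 0, 1, 0, 1]`, 225A1) has discriminant `Δ = -27 · 5² = -675 = -3³ · 5²`
(bad reduction exactly at `3` and `5`). [folklore] -/
theorem cremona225a1_Δ : (⟨0, 0, 1, 0, 1⟩ : WeierstrassCurve ℚ).Δ = -675 := by
  norm_num [WeierstrassCurve.Δ, WeierstrassCurve.b₂, WeierstrassCurve.b₄, WeierstrassCurve.b₆,
    WeierstrassCurve.b₈]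

/-- The printed model `v² - v = t³ + 1` (`[0, 0, -1, 0, 1]`) likewise has `Δ = -675 ≠ 0` (it is an
elliptic curve). [folklore] -/
theorem Xns3ns5_weierstrass_Δ : (⟨0, 0, -1, 0, 1⟩ : WeierstrassCurve ℚ).Δ = -675 := by
  norm_num [WeierstrassCurve.Δ, WeierstrassCurve.b₂, WeierstrassCurve.b₄, WeierstrassCurve.b₆,
    WeierstrassCurve.b₈]

/-- `y² + y = x³ + 1` has `c₄ = 0` (`b₂ = b₄ = 0`), so `j = c₄³/Δ = 0` (CM by `ℤ[ζ₃]`).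
[folklore] -/
theorem cremona225a1_c₄ : (⟨0, 0, 1, 0, 1⟩ : WeierstrassCurve ℚ).c₄ = 0 := by
  norm_num [WeierstrassCurve.c₄, WeierstrassCurve.b₂, WeierstrassCurve.b₄]

/-! ### Prop. 7.2.1: the model of `X(ns3°, b5)` -/

/-- **The fibre product `X(ns3, b5) = X(ns3) ×_{X(1)} X(b5)`** (proof of Prop. 7.2.1): with the
printed coordinates `j = x³` on `X(ns3)` and `j = (y² + 250y + 5⁵)³/y⁵` on `X(b5)`
(Prop. 7.1.3 (2), (3)), the substitution `x = (t⁶ + 250t³ + 5⁵)/t⁵`, `y = t³` solves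
`x³ = (y² + 250y + 5⁵)³/y⁵`, both sides being `j(t) = (t⁶ + 250t³ + 5⁵)³/t¹⁵` ("`X(ns3, b5)` is
isomorphic to `ℙ¹_ℚ` with `j`-invariant given by `j(x) = (x⁶ + 250x³ + 5⁵)³/x¹⁵`"), and the
Fricke involution `w₅ : y ↦ 5³/y` of `X(b5)` is induced by `t ↦ 5/t` (`(5/t)³ = 5³/t³`).
[cite: CaraianiNewton2023, Prop. 7.1.3 (2)–(3) and proof of Prop. 7.2.1] -/
theorem Xns3b5_parametrisation (t : K) :
    ((t ^ 6 + 250 * t ^ 3 + 5 ^ 5) / t ^ 5) ^ 3 =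
        ((t ^ 3) ^ 2 + 250 * t ^ 3 + 5 ^ 5) ^ 3 / (t ^ 3) ^ 5 ∧
      ((t ^ 6 + 250 * t ^ 3 + 5 ^ 5) / t ^ 5) ^ 3 = (t ^ 6 + 250 * t ^ 3 + 5 ^ 5) ^ 3 / t ^ 15 ∧
        (5 / t) ^ 3 = 5 ^ 3 / t ^ 3 := by
  refine ⟨?_, ?_, ?_⟩ <;> rw [div_pow] <;> ring

/-- **The fibre of `j` at `1728` on `X(ns3, b5)`** (proof of Prop. 7.2.1, the displayed
factorisation): `(t⁶ + 250t³ + 5⁵)³ - 1728t¹⁵ =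
(t² - 5t - 25)²(t² - 2t + 5)(t⁴ + 2t³ - t² + 10t + 25)(t⁴ + 5t³ + 50t² - 125t + 625)²`, in any
commutative ring. The simple quartic factor `t⁴ + 2t³ - t² + 10t + 25` is the ramification locus
of `X(ns3°, b5) → X(ns3, b5)` and gives the model `y² = -3(x⁴ + 2x³ - x² + 10x + 25)`.
[cite: CaraianiNewton2023, proof of Prop. 7.2.1] -/
theorem Xns3b5_j_sub_1728_factorisation {R : Type*} [CommRing R] (t : R) :
    (t ^ 6 + 250 * t ^ 3 + 5 ^ 5) ^ 3 - 1728 * t ^ 15 =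
      (t ^ 2 - 5 * t - 25) ^ 2 * (t ^ 2 - 2 * t + 5) * (t ^ 4 + 2 * t ^ 3 - t ^ 2 + 10 * t + 25) *
        (t ^ 4 + 5 * t ^ 3 + 50 * t ^ 2 - 125 * t + 625) ^ 2 := by
  ring

/-- "The unique rational point of `X(ns3)` with `j`-invariant `1728` is `x = 12`" (proof of
Prop. 7.2.1; `j = x³` on `X(ns3)`, Prop. 7.1.3 (3)): over `ℚ`, `x³ = 1728 ↔ x = 12`, since
`x³ - 1728 = (x - 12)((x + 6)² + 108)`. [cite: CaraianiNewton2023, proof of Prop. 7.2.1] -/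
theorem Xns3_j_eq_1728_iff (x : ℚ) : x ^ 3 = 1728 ↔ x = 12 := by
  constructor
  · intro h
    have h' : (x - 12) * ((x + 6) ^ 2 + 108) = 0 := by linear_combination h
    rcases mul_eq_zero.1 h' with h0 | h0
    · linarith
    · nlinarith [sq_nonneg (x + 6)]
  · rintro rfl
    norm_num

/-- The fibre of the double cover `X(ns3°) → X(ns3)`, `y² = d(x² + 12x + 144)`, over the point
`x = 12` is `y² = 432d`, and `432d = 12² · (3d)`, so its field of definition is `ℚ(√(3d))`
(proof of Prop. 7.2.1, determination of `d = -3`).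
[cite: CaraianiNewton2023, proof of Prop. 7.2.1] -/
theorem Xns3o_fibre_at_twelve (d : ℚ) :
    d * ((12 : ℚ) ^ 2 + 12 * 12 + 144) = 432 * d ∧ (432 : ℚ) * d = 12 ^ 2 * (3 * d) := by
  constructor <;> ring

/-- **Prop. 7.2.1 (2): `w₅` on the model `C : y² = -3(x⁴ + 2x³ - x² + 10x + 25)` of
`X(ns3°, b5)`.** The printed action `x ↦ 5/x` of `w₅` on `x`-coordinates lifts to the involution
`(x, y) ↦ (5/x, 5y/x²)` of `C`: since `x⁴ f(5/x) = 25 f(x)` for the quartic `f`, if `(x, y) ∈ C`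
with `x ≠ 0` then `(5/x, 5y/x²) ∈ C`. [cite: CaraianiNewton2023, Prop. 7.2.1 (2)] -/
theorem Cns3ob5_w5 {x y : K} (hx : x ≠ 0)
    (h : y ^ 2 = -3 * (x ^ 4 + 2 * x ^ 3 - x ^ 2 + 10 * x + 25)) :
    (5 * y / x ^ 2) ^ 2 =
      -3 * ((5 / x) ^ 4 + 2 * (5 / x) ^ 3 - (5 / x) ^ 2 + 10 * (5 / x) + 25) := by
  field_simp
  linear_combination 25 * h

/-! ### Prop. 7.2.2: `C(ℚ) = ∅` and the two pointless conics -/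

/-- The quartic of the model `C` of `X(ns3°, b5)` is a sum of two squares:
`x⁴ + 2x³ - x² + 10x + 25 = (x² + x - 3)² + 4(x + 2)²`. [folklore] -/
theorem Cns3ob5_quartic_eq_sos {R : Type*} [CommRing R] (x : R) :
    x ^ 4 + 2 * x ^ 3 - x ^ 2 + 10 * x + 25 = (x ^ 2 + x - 3) ^ 2 + 4 * (x + 2) ^ 2 := by
  ring

/-- The quartic `x⁴ + 2x³ - x² + 10x + 25` is strictly positive on any linearly ordered field (the
two squares in `Cns3ob5_quartic_eq_sos` do not vanish simultaneously: at `x = -2` the first is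
`1`). [folklore] -/
theorem Cns3ob5_quartic_pos {L : Type*} [Field L] [LinearOrder L] [IsStrictOrderedRing L] (x : L) :
    0 < x ^ 4 + 2 * x ^ 3 - x ^ 2 + 10 * x + 25 := by
  rw [Cns3ob5_quartic_eq_sos]
  by_cases hx : x + 2 = 0
  · have hx' : x = -2 := by linear_combination hx
    subst hx'
    norm_num
  · have h4 : 0 < 4 * (x + 2) ^ 2 := mul_pos (by norm_num) (sq_pos_iff.mpr hx)
    nlinarith [sq_nonneg (x ^ 2 + x - 3)]

/-- **`C(ℚ) = ∅`, affine part** ("We have `C(ℚ) = ∅`, as can be checked `3`-adically", p. 95; it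
already fails over `ℝ`): `y² = -3(x⁴ + 2x³ - x² + 10x + 25)` has no solution in a linearly
ordered field, the right-hand side being negative (`Cns3ob5_quartic_pos`).
[cite: CaraianiNewton2023, §7.2 (after Prop. 7.2.1)] -/
theorem Cns3ob5_no_real_points {L : Type*} [Field L] [LinearOrder L] [IsStrictOrderedRing L]
    (x y : L) : y ^ 2 ≠ -3 * (x ^ 4 + 2 * x ^ 3 - x ^ 2 + 10 * x + 25) := by
  intro h
  have := Cns3ob5_quartic_pos x
  nlinarith [sq_nonneg y]

/-- **`C(ℚ) = ∅`, points at infinity**: in the weighted projective plane `ℙ(1, 2, 1)` the points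
of `C` on `z = 0` satisfy `y² = -3x⁴`, which forces `x = y = 0` over a linearly ordered field; so
the two points at infinity `∞± = (1 : ±√-3 : 0)` are not real (they are defined over `ℚ(√-3)`,
`Cns3ob5_points`). [cite: CaraianiNewton2023, §7.2] -/
theorem Cns3ob5_no_real_points_at_infinity {L : Type*} [Field L] [LinearOrder L]
    [IsStrictOrderedRing L] {x y : L} (h : y ^ 2 = -3 * x ^ 4) : x = 0 ∧ y = 0 := by
  have hx4 : 0 ≤ x ^ 4 := by positivity
  have hy : y = 0 := by nlinarith [sq_nonneg y]
  subst hy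
  refine ⟨?_, rfl⟩
  have : x ^ 4 = 0 := by nlinarith
  exact (pow_eq_zero_iff (by norm_num)).1 this

/-- **The conic of the divisor class `[E₁]` has no rational point** (proof of Prop. 7.2.2: "The
equation `α₀² + 3α₁² + 6α₁ + 15 = 0` has no rational solutions (check `3`-adically)"): indeed
`α₀² + 3α₁² + 6α₁ + 15 = α₀² + 3(α₁ + 1)² + 12 > 0` in any linearly ordered field.
[cite: CaraianiNewton2023, proof of Prop. 7.2.2] -/
theorem Cns3ob5_conic_E₁_no_points {L : Type*} [Field L] [LinearOrder L] [IsStrictOrderedRing L]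
    (a b : L) : a ^ 2 + 3 * b ^ 2 + 6 * b + 15 ≠ 0 := by
  nlinarith [sq_nonneg a, sq_nonneg (b + 1)]

/-- **The conic of the divisor class `[E₂]` has no rational point** (proof of Prop. 7.2.2:
"`α₀² + 3α₁² + 6α₁ + 12 = 0` … again has no rational points (check `3`-adically)"): indeed
`α₀² + 3α₁² + 6α₁ + 12 = α₀² + 3(α₁ + 1)² + 9 > 0` in any linearly ordered field.
[cite: CaraianiNewton2023, proof of Prop. 7.2.2] -/
theorem Cns3ob5_conic_E₂_no_points {L : Type*} [Field L] [LinearOrder L] [IsStrictOrderedRing L]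
    (a b : L) : a ^ 2 + 3 * b ^ 2 + 6 * b + 12 ≠ 0 := by
  nlinarith [sq_nonneg a, sq_nonneg (b + 1)]

/-- Remark 7.2.3: the conic `α₀² + 3α₁² + 6α₁ - 33 = 0` of the divisor `E₀` does have the rational
point `(α₀, α₁) = (3, 2)` (corresponding to `α = 3 + 2√-3`).
[cite: CaraianiNewton2023, Rem. 7.2.3] -/
theorem Cns3ob5_conic_E₀_point : (3 : ℚ) ^ 2 + 3 * 2 ^ 2 + 6 * 2 - 33 = 0 := by
  norm_num

/-! ### The points of `C` over `ℚ(√-3)` and `ℚ(√-3, i)` used in §7.2 -/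

/-- **The points of `C : y² = -3(x⁴ + 2x³ - x² + 10x + 25)` over `ℚ(√-3)` listed on p. 95**: with
`s² = -3` (`s = √-3`), the affine points `0₊ = (0, 5s)`, `P₁ = (-2, -s)`, `P₂ = (-5/2, 5s/4)` lie
on `C`, and `(x, y) = (1, ±s)` solve the equation `y² = -3x⁴` of `C ∩ {z = 0}` in `ℙ(1, 2, 1)`
(the points `∞± = (1 : ±√-3 : 0)`). [cite: CaraianiNewton2023, §7.2 (p. 95)] -/
theorem Cns3ob5_points [CharZero K] {s : K} (hs : s ^ 2 = -3) :
    (5 * s) ^ 2 = -3 * ((0 : K) ^ 4 + 2 * 0 ^ 3 - 0 ^ 2 + 10 * 0 + 25) ∧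
      (-s) ^ 2 = -3 * ((-2 : K) ^ 4 + 2 * (-2) ^ 3 - (-2) ^ 2 + 10 * (-2) + 25) ∧
        (5 * s / 4) ^ 2 =
          -3 * ((-5 / 2 : K) ^ 4 + 2 * (-5 / 2) ^ 3 - (-5 / 2) ^ 2 + 10 * (-5 / 2) + 25) ∧
          s ^ 2 = -3 * (1 : K) ^ 4 ∧ (-s) ^ 2 = -3 * (1 : K) ^ 4 := by
  refine ⟨?_, ?_, ?_, ?_, ?_⟩
  · linear_combination 25 * hs
  · linear_combination hs
  · linear_combination (25 / 16 : K) * hs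
  · linear_combination hs
  · linear_combination hs

/-- **The solution of equation (7.2.1)** (p. 96): with `s² = -3`, `i² = -1`, `α = 3 + 2s` and
`x = 1 + 2i`, the equation `(6 - 2sα)x² + (α² - 33)x + (30 - 10sα) = 0` (7.2.1) holds — it is
`3(6 - 2s)(x² - 2x + 5) = 0`, "rescales to `x² + ⋯ + 5 = 0`", so `x(P)x(σ(P)) = (1 + 2i)(1 - 2i)
= 5` — and `P = (1 + 2i, 3 + 6i)` is a point of `C` on the line `y = αx - (sx² + 5s)`, i.e. a
zero of `f₀ - α`. [cite: CaraianiNewton2023, proof of Prop. 7.2.2 (eq. (7.2.1))] -/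
theorem Cns3ob5_eq721_solution [CharZero K] {s i : K} (hs : s ^ 2 = -3) (hi : i ^ 2 = -1) :
    let α := 3 + 2 * s
    let x := 1 + 2 * i
    let y := 3 + 6 * i
    (6 - 2 * s * α) * x ^ 2 + (α ^ 2 - 33) * x + (30 - 10 * s * α) = 0 ∧
      y ^ 2 = -3 * (x ^ 4 + 2 * x ^ 3 - x ^ 2 + 10 * x + 25) ∧
        y = α * x - (s * x ^ 2 + 5 * s) ∧ x * (1 - 2 * i) = 5 := by
  refine ⟨?_, ?_, ?_, ?_⟩
  · linear_combination (-4 * (1 + 2 * i) ^ 2 + 4 * (1 + 2 * i) - 20) * hs +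
      (12 * (6 - 2 * s)) * hi
  · linear_combination (48 * i ^ 2 + 144 * i + 120) * hi
  · linear_combination (4 * s) * hi
  · linear_combination (-4 : K) * hi

end SmallModularCurves

/-! ## §7.3–§7.4 and Lemma 7.1.1 of the source: further explicit algebra

* **Prop. 7.3.1** (p. 97), proof of (3): for the hyperelliptic model
  `y² = 9x⁶ - 6x⁵ - 35x⁴ + 40x² + 12x - 8` of `X(b3, ns5)`, "this polynomial has `3` rational roots
  and an irreducible cubic factor over `ℚ`, whence it follows that there are `4` rational
  `2`-torsion points": the sextic is `(x + 1)(x - 2)(3x - 1)(3x³ + 2x² - 4x - 4)`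
  (`Xb3ns5_sextic_factorisation`) and the cubic factor has no rational root
  (`Xb3ns5_cubic_no_rat_root`, by the rational root theorem: `d ∣ 3`, `n ∣ 4`), hence is
  irreducible over `ℚ` (`Xb3ns5_cubic_irreducible`). **Prop. 7.3.3**: the printed points
  `((-5 + √-11)/6, ±(17 - √-11)/6)` lie on this model (`Xb3ns5_points`).
* **Prop. 7.4.3** (p. 100): the printed involutions of the plane quartics `C₁ ≅ X(ns3°, ns5)` and
  `C₂ ≅ X(s3, ns5)` do preserve them — `w₁ : (x, y) ↦ (x, -y - 1)` leaves the equation of `C₁`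
  invariant identically (`Xns3ons5_quartic_w1`); `w₂` is the projectivity of the matrix
  `M = (3, 1, 2; 8, 1, -8; 4, -2, 1)` with `M² = 25·I` (`Xs3ns5_w2_matrix_sq`), the homogenised
  quartic `F₂` of `C₂` satisfies `F₂ ∘ M = 625·F₂` (`Xs3ns5_quartic_w2_homogeneous`), so `w₂`
  maps affine points of `C₂` with `4x - 2y + 1 ≠ 0` to points of `C₂` and is an involution there
  (`Xs3ns5_quartic_w2`, `Xs3ns5_w2_involutive`) — and the two printed points
  `P₁ = ((1 + √-55)/28, (27 - √-55)/56)`, `P₂ = ((3 - √-55)/4, (3 + 3√-55)/4)` lie on `C₂`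
  (`Xs3ns5_quartic_points`, part of (3); their `j`-invariant `-32768` is not certified here).
* **Lemma 7.1.1 and Prop. 7.2.1, the `𝔽₃`-linear algebra**: with
  `C_ns(3) = {(x, -y; y, x) : (x, y) ≠ (0, 0)}` as printed (p. 92),
  "`C_ns ∩ SL₂(𝔽₃) = ⟨(0, -1; 1, 0)⟩` is cyclic of order `4`" (`Cns3_det_eq_one_iff`: the
  norm-one elements are `±1, ±w`, `w = (0, -1; 1, 0)`, and `w² = -1`, `Cns3_w_sq`), "and is also
  contained in the normalizer of the diagonal split Cartan" (`Cns3_w_mul_diagonal`: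
  `w·diag(a, b) = diag(b, a)·w`); and "non-split Cartans mod `3` contain no element conjugate to
  `diag(1, -1)`" (proof of Prop. 7.2.1; `Cns3_not_isConj_diag`, by comparing determinant and
  trace).
[cite: CaraianiNewton2023, Lemma 7.1.1 (proof), Prop. 7.2.1 (proof), Prop. 7.3.1, Prop. 7.4.3]
-/

section SmallModularCurvesII

variable {K : Type*} [Field K]

/-! ### Prop. 7.3.1: the sextic of `X(b3, ns5)` -/

/-- **The sextic of the hyperelliptic model `y² = 9x⁶ - 6x⁵ - 35x⁴ + 40x² + 12x - 8` of
`X(b3, ns5)` factors as `(x + 1)(x - 2)(3x - 1)(3x³ + 2x² - 4x - 4)`** (rational roots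
`-1, 2, 1/3`), in any commutative ring. [cite: CaraianiNewton2023, Prop. 7.3.1 (proof of (3))] -/
theorem Xb3ns5_sextic_factorisation {R : Type*} [CommRing R] (x : R) :
    9 * x ^ 6 - 6 * x ^ 5 - 35 * x ^ 4 + 40 * x ^ 2 + 12 * x - 8 =
      (x + 1) * (x - 2) * (3 * x - 1) * (3 * x ^ 3 + 2 * x ^ 2 - 4 * x - 4) := by
  ring

/-- **The cubic factor `3x³ + 2x² - 4x - 4` has no rational root** (rational root theorem: for
`x = n/d` in lowest terms, `3n³ + 2n²d - 4nd² - 4d³ = 0` forces `d ∣ 3` and `n ∣ 4`, and none of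
the candidates is a root). [cite: CaraianiNewton2023, Prop. 7.3.1 (proof of (3))] -/
theorem Xb3ns5_cubic_no_rat_root (x : ℚ) : 3 * x ^ 3 + 2 * x ^ 2 - 4 * x - 4 ≠ 0 := by
  intro h
  obtain ⟨n, d, hd, hcop, rfl⟩ : ∃ n : ℤ, ∃ d : ℕ, 0 < d ∧ n.natAbs.Coprime d ∧ x = n / d :=
    ⟨x.num, x.den, x.den_pos, x.reduced, (Rat.num_div_den x).symm⟩
  have hd0 : (d : ℚ) ≠ 0 := by exact_mod_cast hd.ne'
  have key : (3 * n ^ 3 + 2 * n ^ 2 * d - 4 * n * d ^ 2 - 4 * d ^ 3 : ℚ) = 0 := by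
    field_simp at h
    linear_combination h
  have keyZ : 3 * n ^ 3 + 2 * n ^ 2 * d - 4 * n * (d : ℤ) ^ 2 - 4 * (d : ℤ) ^ 3 = 0 := by
    exact_mod_cast key
  have hd3 : (d : ℤ) ∣ 3 := by
    have h1 : (d : ℤ) ∣ 3 * n ^ 3 :=
      ⟨-(2 * n ^ 2) + 4 * n * d + 4 * d ^ 2, by linear_combination keyZ⟩
    have hc : IsCoprime (d : ℤ) (n ^ 3) := by
      apply IsCoprime.pow_right
      rw [Int.isCoprime_iff_gcd_eq_one]
      simpa [Int.gcd, Nat.Coprime, Nat.coprime_comm] using hcop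
    exact hc.dvd_of_dvd_mul_right h1
  have hn4 : n ∣ 4 := by
    have h1 : n ∣ 4 * (d : ℤ) ^ 3 :=
      ⟨3 * n ^ 2 + 2 * n * d - 4 * d ^ 2, by linear_combination -keyZ⟩
    have hc : IsCoprime n ((d : ℤ) ^ 3) := by
      apply IsCoprime.pow_right
      rw [Int.isCoprime_iff_gcd_eq_one]
      simpa [Int.gcd, Nat.Coprime] using hcop
    exact hc.dvd_of_dvd_mul_right h1
  have hdle : d ≤ 3 := by
    have := Int.le_of_dvd (by norm_num) hd3
    omega
  have hnle : n.natAbs ≤ 4 := by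
    have h4 : n.natAbs ∣ 4 := by simpa using Int.natAbs_dvd_natAbs.2 hn4
    exact Nat.le_of_dvd (by norm_num) h4
  obtain ⟨hn₁, hn₂⟩ : -4 ≤ n ∧ n ≤ 4 := by omega
  interval_cases d <;> interval_cases n <;> norm_num at keyZ

open Polynomial in
/-- Hence **the cubic factor `3X³ + 2X² - 4X - 4 ∈ ℚ[X]` is irreducible** (a cubic over a field
without roots is irreducible), as asserted in the proof of Prop. 7.3.1 (3) ("an irreducible cubic
factor over `ℚ`"; so the sextic has exactly the three rational roots `-1, 2, 1/3`, giving
`|Jac(C)(ℚ)[2]| = 4`). [cite: CaraianiNewton2023, Prop. 7.3.1 (proof of (3))] -/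
theorem Xb3ns5_cubic_irreducible :
    Irreducible (C 3 * X ^ 3 + C 2 * X ^ 2 + C (-4) * X + C (-4) : ℚ[X]) := by
  apply irreducible_of_degree_le_three_of_not_isRoot
  · rw [natDegree_cubic (by norm_num)]
    decide
  · intro x hx
    apply Xb3ns5_cubic_no_rat_root x
    simp only [IsRoot.def, eval_add, eval_mul, eval_C, eval_pow, eval_X] at hx
    linear_combination hx

/-- **Prop. 7.3.3: the points `((-5 + √-11)/6, ±(17 - √-11)/6)` lie on the hyperelliptic model
`C : y² = 9x⁶ - 6x⁵ - 35x⁴ + 40x² + 12x - 8` of `X(b3, ns5)`** (over any field of characteristic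
`0` containing `s` with `s² = -11`). Up to complex conjugation these are the printed imaginary
quadratic points of `C` with `x ∉ ℚ` (the curve 8100.2-a2 over `ℚ(√-11)` of Cor. 7.3.4); that
they are the *only* ones is the Mordell–Weil / Mumford-representation computation of Prop. 7.3.3,
not certified here. [cite: CaraianiNewton2023, Prop. 7.3.3] -/
theorem Xb3ns5_points [CharZero K] {s : K} (hs : s ^ 2 = -11) :
    ((17 - s) / 6) ^ 2 = 9 * ((-5 + s) / 6) ^ 6 - 6 * ((-5 + s) / 6) ^ 5 - 35 * ((-5 + s) / 6) ^ 4 +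
        40 * ((-5 + s) / 6) ^ 2 + 12 * ((-5 + s) / 6) - 8 ∧
      (-((17 - s) / 6)) ^ 2 = 9 * ((-5 + s) / 6) ^ 6 - 6 * ((-5 + s) / 6) ^ 5 -
        35 * ((-5 + s) / 6) ^ 4 + 40 * ((-5 + s) / 6) ^ 2 + 12 * ((-5 + s) / 6) - 8 := by
  constructor <;>
    linear_combination
      (-s ^ 4 / 5184 + 17 * s ^ 3 / 2592 - s ^ 2 / 16 + 163 * s / 2592 + 4573 / 5184) * hs

/-! ### Prop. 7.4.3: the involutions of the plane quartics `C₁`, `C₂` and the points `P₁`, `P₂` -/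

/-- **Prop. 7.4.3 (1): `w₁ : (x, y) ↦ (x, -y - 1)` is an automorphism of the plane quartic
`C₁ : 9x⁴ + 19x²y² + y⁴ + 9x³ + 19x²y + 22xy² + 2y³ + 10x² + 22xy + 13y² + 7x + 12y + 11 = 0`
(`≅ X(ns3°, ns5)`)** — the defining quartic is invariant under `w₁` identically, in any
commutative ring. [cite: CaraianiNewton2023, Prop. 7.4.3 (1)] -/
theorem Xns3ons5_quartic_w1 {R : Type*} [CommRing R] (x y : R) :
    9 * x ^ 4 + 19 * x ^ 2 * (-y - 1) ^ 2 + (-y - 1) ^ 4 + 9 * x ^ 3 + 19 * x ^ 2 * (-y - 1) +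
        22 * x * (-y - 1) ^ 2 + 2 * (-y - 1) ^ 3 + 10 * x ^ 2 + 22 * x * (-y - 1) +
        13 * (-y - 1) ^ 2 + 7 * x + 12 * (-y - 1) + 11 =
      9 * x ^ 4 + 19 * x ^ 2 * y ^ 2 + y ^ 4 + 9 * x ^ 3 + 19 * x ^ 2 * y + 22 * x * y ^ 2 +
        2 * y ^ 3 + 10 * x ^ 2 + 22 * x * y + 13 * y ^ 2 + 7 * x + 12 * y + 11 := by
  ring

/-- **Prop. 7.4.3 (2): the matrix `M = (3, 1, 2; 8, 1, -8; 4, -2, 1)` of the projectivity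
`w₂ : (x, y) ↦ ((3x + y + 2)/(4x - 2y + 1), (8x + y - 8)/(4x - 2y + 1))` satisfies `M² = 25·I`**
(so `w₂` is an involution of `ℙ²`); written out entrywise on a vector `(x, y, z)`.
[cite: CaraianiNewton2023, Prop. 7.4.3 (2)] -/
theorem Xs3ns5_w2_matrix_sq {R : Type*} [CommRing R] (x y z : R) :
    let x' := 3 * x + y + 2 * z
    let y' := 8 * x + y - 8 * z
    let z' := 4 * x - 2 * y + z
    3 * x' + y' + 2 * z' = 25 * x ∧ 8 * x' + y' - 8 * z' = 25 * y ∧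
      4 * x' - 2 * y' + z' = 25 * z := by
  refine ⟨?_, ?_, ?_⟩ <;> ring

/-- **Prop. 7.4.3 (2): `w₂` preserves `C₂ ≅ X(s3, ns5)` — homogeneous form.** For the
homogenisation `F₂(x, y, z) = -x⁴ + 2x³y + x²y² + 8x³z + 2x²yz - 2xy²z - y³z - 3x²z² - 3xyz² +
3y²z² + 2xz³ - 3yz³ + z⁴` of the printed quartic `C₂` and the matrix `M` of `w₂`,
`F₂(M(x, y, z)) = 625·F₂(x, y, z)` identically, in any commutative ring.
[cite: CaraianiNewton2023, Prop. 7.4.3 (2)] -/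
theorem Xs3ns5_quartic_w2_homogeneous {R : Type*} [CommRing R] (x y z : R) :
    let F : R → R → R → R := fun x y z ↦ -x ^ 4 + 2 * x ^ 3 * y + x ^ 2 * y ^ 2 + 8 * x ^ 3 * z +
      2 * x ^ 2 * y * z - 2 * x * y ^ 2 * z - y ^ 3 * z - 3 * x ^ 2 * z ^ 2 - 3 * x * y * z ^ 2 +
      3 * y ^ 2 * z ^ 2 + 2 * x * z ^ 3 - 3 * y * z ^ 3 + z ^ 4
    F (3 * x + y + 2 * z) (8 * x + y - 8 * z) (4 * x - 2 * y + z) = 625 * F x y z := by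
  simp only
  ring

/-- **Prop. 7.4.3 (2): `w₂` maps points of `C₂` to points of `C₂`.** If `(x, y)` lies on the
printed affine quartic `C₂ : -x⁴ + 2x³y + x²y² + 8x³ + 2x²y - 2xy² - y³ - 3x² - 3xy + 3y² + 2x -
3y + 1 = 0` and `4x - 2y + 1 ≠ 0`, then so does
`w₂(x, y) = ((3x + y + 2)/(4x - 2y + 1), (8x + y - 8)/(4x - 2y + 1))`.
[cite: CaraianiNewton2023, Prop. 7.4.3 (2)] -/
theorem Xs3ns5_quartic_w2 [CharZero K] {x y x' y' : K} (hD : 4 * x - 2 * y + 1 ≠ 0)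
    (h : -x ^ 4 + 2 * x ^ 3 * y + x ^ 2 * y ^ 2 + 8 * x ^ 3 + 2 * x ^ 2 * y - 2 * x * y ^ 2 -
      y ^ 3 - 3 * x ^ 2 - 3 * x * y + 3 * y ^ 2 + 2 * x - 3 * y + 1 = 0)
    (hx' : x' = (3 * x + y + 2) / (4 * x - 2 * y + 1))
    (hy' : y' = (8 * x + y - 8) / (4 * x - 2 * y + 1)) :
    -x' ^ 4 + 2 * x' ^ 3 * y' + x' ^ 2 * y' ^ 2 + 8 * x' ^ 3 + 2 * x' ^ 2 * y' - 2 * x' * y' ^ 2 -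
      y' ^ 3 - 3 * x' ^ 2 - 3 * x' * y' + 3 * y' ^ 2 + 2 * x' - 3 * y' + 1 = 0 := by
  set D := 4 * x - 2 * y + 1 with hD_def
  subst hx' hy'
  field_simp
  rw [hD_def]
  linear_combination 625 * h

/-- **Prop. 7.4.3 (2): `w₂` is an involution** on the affine chart `4x - 2y + 1 ≠ 0` (which it
preserves: `4x' - 2y' + 1 = 25/(4x - 2y + 1)`): `w₂(w₂(x, y)) = (x, y)`.
[cite: CaraianiNewton2023, Prop. 7.4.3 (2)] -/
theorem Xs3ns5_w2_involutive [CharZero K] {x y x' y' : K} (hD : 4 * x - 2 * y + 1 ≠ 0)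
    (hx' : x' = (3 * x + y + 2) / (4 * x - 2 * y + 1))
    (hy' : y' = (8 * x + y - 8) / (4 * x - 2 * y + 1)) :
    4 * x' - 2 * y' + 1 = 25 / (4 * x - 2 * y + 1) ∧
      (3 * x' + y' + 2) / (4 * x' - 2 * y' + 1) = x ∧
        (8 * x' + y' - 8) / (4 * x' - 2 * y' + 1) = y := by
  set D := 4 * x - 2 * y + 1 with hD_def
  subst hx' hy'
  have e : 4 * ((3 * x + y + 2) / D) - 2 * ((8 * x + y - 8) / D) + 1 = 25 / D := by
    field_simp
    rw [hD_def]
    ring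
  refine ⟨e, ?_, ?_⟩ <;> rw [e] <;> field_simp <;> rw [hD_def] <;> ring

/-- **Prop. 7.4.3 (3): the points `P₁ = ((1 + √-55)/28, (27 - √-55)/56)` and
`P₂ = ((3 - √-55)/4, (3 + 3√-55)/4)` lie on `C₂`** (over any field of characteristic `0`
containing `s` with `s² = -55`). Their `j`-invariant `-32768 = -2¹⁵` (loc. cit.) is not certified
here. [cite: CaraianiNewton2023, Prop. 7.4.3 (3)] -/
theorem Xs3ns5_quartic_points [CharZero K] {s : K} (hs : s ^ 2 = -55) :
    let F : K → K → K := fun x y ↦ -x ^ 4 + 2 * x ^ 3 * y + x ^ 2 * y ^ 2 + 8 * x ^ 3 +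
      2 * x ^ 2 * y - 2 * x * y ^ 2 - y ^ 3 - 3 * x ^ 2 - 3 * x * y + 3 * y ^ 2 + 2 * x - 3 * y + 1
    F ((1 + s) / 28) ((27 - s) / 56) = 0 ∧ F ((3 - s) / 4) ((3 + 3 * s) / 4) = 0 := by
  constructor
  · linear_combination ((895 + 110 * s - s ^ 2) / 351232) * hs
  · linear_combination ((s ^ 2 - 10 * s + 5) / 128) * hs

/-! ### Lemma 7.1.1 and Prop. 7.2.1: linear algebra in `GL₂(𝔽₃)` -/

/-- **`C_ns(3) ∩ SL₂(𝔽₃) = {±1, ±w}`, `w = (0, -1; 1, 0)`** (proof of Lemma 7.1.1 (2):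
"`C_ns ∩ SL₂(𝔽₃) = ⟨(0, -1; 1, 0)⟩` is cyclic of order `4`"): for the printed non-split Cartan
`C_ns(3) = {(x, -y; y, x)}` of `GL₂(𝔽₃)`, `det (x, -y; y, x) = x² + y² = 1` iff
`(x, y) ∈ {(±1, 0), (0, ±1)}`. [cite: CaraianiNewton2023, Lemma 7.1.1 (proof of (2))] -/
theorem Cns3_det_eq_one_iff (x y : ZMod 3) :
    Matrix.det !![x, -y; y, x] = 1 ↔
      (y = 0 ∧ (x = 1 ∨ x = -1)) ∨ (x = 0 ∧ (y = 1 ∨ y = -1)) := by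
  rw [Matrix.det_fin_two_of]
  revert x y
  decide

/-- `w = (0, -1; 1, 0)` has `w² = -1` in `M₂(R)` (so `w` has order `4` in `GL₂(𝔽₃)` and generates
`C_ns(3) ∩ SL₂(𝔽₃) = {±1, ±w}`). [cite: CaraianiNewton2023, Lemma 7.1.1 (proof of (2))] -/
theorem Cns3_w_sq {R : Type*} [CommRing R] :
    (!![0, -1; 1, 0] : Matrix (Fin 2) (Fin 2) R) * !![0, -1; 1, 0] = -1 := by
  ext i j
  fin_cases i <;> fin_cases j <;> simp [Matrix.mul_apply, Fin.sum_univ_two]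

/-- **`w = (0, -1; 1, 0)` normalises the diagonal split Cartan** ("… and is also contained in the
normalizer of the diagonal split Cartan `C_s(3)`", proof of Lemma 7.1.1 (2)): `w · diag(a, b) =
diag(b, a) · w` in `M₂(R)`. [cite: CaraianiNewton2023, Lemma 7.1.1 (proof of (2))] -/
theorem Cns3_w_mul_diagonal {R : Type*} [CommRing R] (a b : R) :
    (!![0, -1; 1, 0] : Matrix (Fin 2) (Fin 2) R) * !![a, 0; 0, b] =
      !![b, 0; 0, a] * !![0, -1; 1, 0] := by
  ext i j
  fin_cases i <;> fin_cases j <;> simp [Matrix.mul_apply, Fin.sum_univ_two]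

/-- **"Non-split Cartans mod `3` contain no element conjugate to `diag(1, -1)`"** (proof of
Prop. 7.2.1): no matrix `(x, -y; y, x) ∈ M₂(𝔽₃)` is conjugate to `diag(1, -1)` — conjugate matrices
have the same trace and determinant, and `tr = 2x = 0` forces `x = 0`, `det = y² ∈ {0, 1}`, whereas
`det diag(1, -1) = -1`. [cite: CaraianiNewton2023, Prop. 7.2.1 (proof of (1))] -/
theorem Cns3_not_isConj_diag (x y : ZMod 3) :
    ¬ IsConj (!![1, 0; 0, -1] : Matrix (Fin 2) (Fin 2) (ZMod 3)) !![x, -y; y, x] := by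
  rintro ⟨c, hc⟩
  have hb : (!![x, -y; y, x] : Matrix (Fin 2) (Fin 2) (ZMod 3)) =
      (c : Matrix (Fin 2) (Fin 2) (ZMod 3)) * (!![1, 0; 0, -1] : Matrix (Fin 2) (Fin 2) (ZMod 3)) *
        ((c⁻¹ : (Matrix (Fin 2) (Fin 2) (ZMod 3))ˣ) : Matrix (Fin 2) (Fin 2) (ZMod 3)) := by
    rw [hc.eq, Units.mul_inv_cancel_right]
  have hdet := congrArg Matrix.det hb
  have htr := congrArg Matrix.trace hb
  rw [Matrix.det_units_conj, Matrix.det_fin_two_of, Matrix.det_fin_two_of] at hdet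
  rw [Matrix.trace_units_conj, Matrix.trace_fin_two_of, Matrix.trace_fin_two_of] at htr
  have key : ∀ a b : ZMod 3, a * a - -b * b = 1 * -1 - 0 * 0 → a + a = 1 + -1 → False := by
    decide
  exact key x y hdet htr

end SmallModularCurvesII


/-! ## The second curve of the proof of Cor. 7.1.2: `X(s3, b5) = 15A3`, Legendre form
`y² = x(x + 1)(x + 16)`, and its rational torsion `ℤ/4 × ℤ/2`

Source, proof of Cor. 7.1.2 (p. 93): "The curve `X(s3, b5)` is an elliptic curve, with Cremona
label 15A3 ([FLHS15, Lemma 5.7]), and is isogenous to `X₀(15)`. … We also have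
`X(s3, b5)(ℚ) ≅ ℤ/2ℤ × ℤ/4ℤ`. A Legendre form for `X(s3, b5)/ℚ` is `y² = x(x + 1)(x + 16)`".
As for `X₀(15)` above (sections `Torsion`, 15A1), we certify: the printed Legendre equation
`y² = x(x + 1)(x + 16) = x³ + 17x² + 16x`, i.e. the Weierstrass model `⟨0, 17, 0, 16, 0⟩`, is
`ℚ`-isomorphic to Cremona's 15A3 `[1, 1, 1, -5, 2]` (`Δ = 225 = 3² · 5²`) by the admissible change
of variables `(u, r, s, t) = (2, -4, 1, 4)`, and carries the eight rational points
`{aP + bQ}`, `P = (4, 20)` of order `4`, `Q = (-1, 0)` of order `2`, `ℤ/4 × ℤ/2 ↪` its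
Mordell–Weil group (the printed group structure, lower-bound half; rank `0` is again a
`2`-descent not done here, and the isogeny with `X₀(15)` is not formalised). The model is
written as a literal (no new definition). -/

section TorsionXs3b5

open WeierstrassCurve WeierstrassCurve.Affine WeierstrassCurve.Affine.Point

/-- **The Legendre model `y² = x(x + 1)(x + 16)` of `X(s3, b5)` is `ℚ`-isomorphic to 15A3**:
the change of variables `(u, r, s, t) = (2, -4, 1, 4)` (`x = 4x' - 4`, `y = 8y' + 4x' + 4`)
carries `⟨0, 17, 0, 16, 0⟩` to Cremona's reduced minimal model `[1, 1, 1, -5, 2]` of 15A3.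
[folklore] -/
theorem variableChange_Xs3b5Legendre_eq_cremona15a3 :
    (⟨Units.mk0 2 two_ne_zero, -4, 1, 4⟩ : WeierstrassCurve.VariableChange ℚ) •
        (⟨0, 17, 0, 16, 0⟩ : WeierstrassCurve ℚ) = (⟨1, 1, 1, -5, 2⟩ : WeierstrassCurve ℚ) := by
  simp only [WeierstrassCurve.variableChange_def, Units.val_inv_eq_inv_val, Units.val_mk0,
    WeierstrassCurve.mk.injEq]
  norm_num

/-- The inverse isomorphism `(u, r, s, t) = (1/2, 1, -1/2, -1)` from Cremona's 15A3 to the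
printed Legendre model of `X(s3, b5)`. [folklore] -/
theorem cremona15a3_variableChange_eq_Xs3b5Legendre :
    (⟨Units.mk0 2⁻¹ (inv_ne_zero two_ne_zero), 1, -2⁻¹, -1⟩ : WeierstrassCurve.VariableChange ℚ) •
        (⟨1, 1, 1, -5, 2⟩ : WeierstrassCurve ℚ) = (⟨0, 17, 0, 16, 0⟩ : WeierstrassCurve ℚ) := by
  simp only [WeierstrassCurve.variableChange_def, Units.val_inv_eq_inv_val, Units.val_mk0,
    WeierstrassCurve.mk.injEq]
  norm_num

/-- Cremona's model `[1, 1, 1, -5, 2]` of 15A3 has `Δ = 225 = 3² · 5²` (conductor `15`).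
[folklore] -/
theorem cremona15a3_Δ : (⟨1, 1, 1, -5, 2⟩ : WeierstrassCurve ℚ).Δ = 225 := by
  norm_num [WeierstrassCurve.Δ, WeierstrassCurve.b₂, WeierstrassCurve.b₄, WeierstrassCurve.b₆,
    WeierstrassCurve.b₈]

/-- The Legendre model of `X(s3, b5)` has `Δ = 921600 = 2¹² · 225` (`= u¹² · Δ(15A3)`, `u = 2`).
[folklore] -/
theorem Xs3b5Legendre_Δ : (⟨0, 17, 0, 16, 0⟩ : WeierstrassCurve ℚ).Δ = 921600 := by
  norm_num [WeierstrassCurve.Δ, WeierstrassCurve.b₂, WeierstrassCurve.b₄, WeierstrassCurve.b₆,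
    WeierstrassCurve.b₈]

/-- The Legendre model of `X(s3, b5)` has `c₄ = 68² - 24 · 32 = 3856 = 2⁴ · 241` (so
`j = c₄³/Δ = 241³/225 = 13997521/225`, the `j`-invariant of 15A3). [folklore] -/
theorem Xs3b5Legendre_c₄ : (⟨0, 17, 0, 16, 0⟩ : WeierstrassCurve ℚ).c₄ = 3856 := by
  norm_num [WeierstrassCurve.c₄, WeierstrassCurve.b₂, WeierstrassCurve.b₄]

/-- `Δ ≠ 0` for the affine Legendre model of `X(s3, b5)`. [folklore] -/
theorem Xs3b5Legendre_toAffine_Δ_ne_zero :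
    (⟨0, 17, 0, 16, 0⟩ : WeierstrassCurve ℚ).toAffine.Δ ≠ 0 := by
  change (⟨0, 17, 0, 16, 0⟩ : WeierstrassCurve ℚ).Δ ≠ 0
  rw [Xs3b5Legendre_Δ]
  norm_num

/-- **Points of the Legendre model of `X(s3, b5)`**: `(x, y)` is a (nonsingular) affine point iff
`y² = x³ + 17x² + 16x = x(x + 1)(x + 16)`. [folklore] -/
theorem Xs3b5Legendre_nonsingular_iff (x y : ℚ) :
    (⟨0, 17, 0, 16, 0⟩ : WeierstrassCurve ℚ).toAffine.Nonsingular x y ↔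
      y ^ 2 = x ^ 3 + 17 * x ^ 2 + 16 * x := by
  rw [← equation_iff_nonsingular_of_Δ_ne_zero Xs3b5Legendre_toAffine_Δ_ne_zero,
    WeierstrassCurve.Affine.equation_iff]
  change y ^ 2 + 0 * x * y + 0 * y = x ^ 3 + 17 * x ^ 2 + 16 * x + 0 ↔ _
  simp

/-- Negation on the Legendre model of `X(s3, b5)` is `(x, y) ↦ (x, -y)`. [folklore] -/
theorem Xs3b5Legendre_negY (x y : ℚ) :
    (⟨0, 17, 0, 16, 0⟩ : WeierstrassCurve ℚ).toAffine.negY x y = -y := by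
  simp [negY]

/-- `P = (4, 20)`: `20² = 4 · 5 · 20`; a point of order `4`. [folklore] -/
theorem Xs3b5Legendre_nonsingular_P :
    (⟨0, 17, 0, 16, 0⟩ : WeierstrassCurve ℚ).toAffine.Nonsingular 4 20 := by
  rw [Xs3b5Legendre_nonsingular_iff]; norm_num

/-- `Q = (-1, 0)`: a `2`-torsion point. [folklore] -/
theorem Xs3b5Legendre_nonsingular_Q :
    (⟨0, 17, 0, 16, 0⟩ : WeierstrassCurve ℚ).toAffine.Nonsingular (-1) 0 := by
  rw [Xs3b5Legendre_nonsingular_iff]; norm_num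

/-- `2P = (0, 0)`: a `2`-torsion point. [folklore] -/
theorem Xs3b5Legendre_nonsingular_twoP :
    (⟨0, 17, 0, 16, 0⟩ : WeierstrassCurve ℚ).toAffine.Nonsingular 0 0 := by
  rw [Xs3b5Legendre_nonsingular_iff]; norm_num

/-- `3P = -P = (4, -20)`. [folklore] -/
theorem Xs3b5Legendre_nonsingular_threeP :
    (⟨0, 17, 0, 16, 0⟩ : WeierstrassCurve ℚ).toAffine.Nonsingular 4 (-20) := by
  rw [Xs3b5Legendre_nonsingular_iff]; norm_num

/-- `P + Q = (-4, 12)`: `12² = (-4)(-3)(12)`. [folklore] -/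
theorem Xs3b5Legendre_nonsingular_PQ :
    (⟨0, 17, 0, 16, 0⟩ : WeierstrassCurve ℚ).toAffine.Nonsingular (-4) 12 := by
  rw [Xs3b5Legendre_nonsingular_iff]; norm_num

/-- `2P + Q = (-16, 0)`: the third `2`-torsion point. [folklore] -/
theorem Xs3b5Legendre_nonsingular_twoPQ :
    (⟨0, 17, 0, 16, 0⟩ : WeierstrassCurve ℚ).toAffine.Nonsingular (-16) 0 := by
  rw [Xs3b5Legendre_nonsingular_iff]; norm_num

/-- `3P + Q = (-4, -12)`. [folklore] -/
theorem Xs3b5Legendre_nonsingular_threePQ :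
    (⟨0, 17, 0, 16, 0⟩ : WeierstrassCurve ℚ).toAffine.Nonsingular (-4) (-12) := by
  rw [Xs3b5Legendre_nonsingular_iff]; norm_num

/-- **Doubling `P = (4, 20)`**: tangent slope `λ = (3x² + 34x + 16)/(2y) = 200/40 = 5`,
`2P = (λ² - 17 - 2x, …) = (0, 0)`. [folklore] -/
theorem Xs3b5Legendre_P_add_P :
    (.some 4 20 Xs3b5Legendre_nonsingular_P :
        (⟨0, 17, 0, 16, 0⟩ : WeierstrassCurve ℚ).toAffine.Point) +
      .some 4 20 Xs3b5Legendre_nonsingular_P = .some 0 0 Xs3b5Legendre_nonsingular_twoP := by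
  have hy : (20 : ℚ) ≠ (⟨0, 17, 0, 16, 0⟩ : WeierstrassCurve ℚ).toAffine.negY 4 20 := by
    rw [Xs3b5Legendre_negY]; norm_num
  rw [add_self_of_Y_ne hy]
  simp only [some.injEq]
  rw [slope_of_Y_ne rfl hy]
  simp only [addX, addY, negAddY, negY]
  norm_num

/-- **`P + Q = (-4, 12)`** for `P = (4, 20)`, `Q = (-1, 0)`: chord slope `λ = 4`,
`x = λ² - 17 - 4 + 1 = -4`. [folklore] -/
theorem Xs3b5Legendre_P_add_Q :
    (.some 4 20 Xs3b5Legendre_nonsingular_P :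
        (⟨0, 17, 0, 16, 0⟩ : WeierstrassCurve ℚ).toAffine.Point) +
      .some (-1) 0 Xs3b5Legendre_nonsingular_Q = .some (-4) 12 Xs3b5Legendre_nonsingular_PQ := by
  rw [add_of_X_ne (by norm_num : (4 : ℚ) ≠ -1)]
  simp only [some.injEq]
  rw [slope_of_X_ne (by norm_num : (4 : ℚ) ≠ -1)]
  simp only [addX, addY, negAddY, negY]
  norm_num

/-- **`2P + Q = (-16, 0)`**: the sum of the `2`-torsion points `(0, 0)` and `(-1, 0)` is the third
one (roots `0, -1, -16`). [folklore] -/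
theorem Xs3b5Legendre_twoP_add_Q :
    (.some 0 0 Xs3b5Legendre_nonsingular_twoP :
        (⟨0, 17, 0, 16, 0⟩ : WeierstrassCurve ℚ).toAffine.Point) +
      .some (-1) 0 Xs3b5Legendre_nonsingular_Q = .some (-16) 0 Xs3b5Legendre_nonsingular_twoPQ := by
  rw [add_of_X_ne (by norm_num : (0 : ℚ) ≠ -1)]
  simp only [some.injEq]
  rw [slope_of_X_ne (by norm_num : (0 : ℚ) ≠ -1)]
  simp only [addX, addY, negAddY, negY]
  norm_num

/-- **`2P + P = 3P = (4, -20)`**: chord through `(0, 0)` and `(4, 20)`, slope `5`. [folklore] -/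
theorem Xs3b5Legendre_twoP_add_P :
    (.some 0 0 Xs3b5Legendre_nonsingular_twoP :
        (⟨0, 17, 0, 16, 0⟩ : WeierstrassCurve ℚ).toAffine.Point) +
      .some 4 20 Xs3b5Legendre_nonsingular_P = .some 4 (-20) Xs3b5Legendre_nonsingular_threeP := by
  rw [add_of_X_ne (by norm_num : (0 : ℚ) ≠ 4)]
  simp only [some.injEq]
  rw [slope_of_X_ne (by norm_num : (0 : ℚ) ≠ 4)]
  simp only [addX, addY, negAddY, negY]
  norm_num

/-- **`3P + Q = (-4, -12)`**: chord through `3P = (4, -20)` and `Q = (-1, 0)`, slope `-4`.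
[folklore] -/
theorem Xs3b5Legendre_threeP_add_Q :
    (.some 4 (-20) Xs3b5Legendre_nonsingular_threeP :
        (⟨0, 17, 0, 16, 0⟩ : WeierstrassCurve ℚ).toAffine.Point) +
      .some (-1) 0 Xs3b5Legendre_nonsingular_Q =
        .some (-4) (-12) Xs3b5Legendre_nonsingular_threePQ := by
  rw [add_of_X_ne (by norm_num : (4 : ℚ) ≠ -1)]
  simp only [some.injEq]
  rw [slope_of_X_ne (by norm_num : (4 : ℚ) ≠ -1)]
  simp only [addX, addY, negAddY, negY]
  norm_num

/-- **`-P = (4, -20)`** (`= 3P`). [folklore] -/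
theorem Xs3b5Legendre_neg_P :
    -(.some 4 20 Xs3b5Legendre_nonsingular_P :
        (⟨0, 17, 0, 16, 0⟩ : WeierstrassCurve ℚ).toAffine.Point) =
      .some 4 (-20) Xs3b5Legendre_nonsingular_threeP := by
  rw [neg_some]
  simp only [Xs3b5Legendre_negY]

/-- `2 · (0, 0) = O`. [folklore] -/
theorem Xs3b5Legendre_twoP_add_twoP :
    (.some 0 0 Xs3b5Legendre_nonsingular_twoP :
        (⟨0, 17, 0, 16, 0⟩ : WeierstrassCurve ℚ).toAffine.Point) +
      .some 0 0 Xs3b5Legendre_nonsingular_twoP = 0 :=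
  add_self_of_Y_eq (by rw [Xs3b5Legendre_negY]; norm_num)

/-- `2Q = O` for `Q = (-1, 0)`. [folklore] -/
theorem Xs3b5Legendre_Q_add_Q :
    (.some (-1) 0 Xs3b5Legendre_nonsingular_Q :
        (⟨0, 17, 0, 16, 0⟩ : WeierstrassCurve ℚ).toAffine.Point) +
      .some (-1) 0 Xs3b5Legendre_nonsingular_Q = 0 :=
  add_self_of_Y_eq (by rw [Xs3b5Legendre_negY]; norm_num)

/-- **`Q = (-1, 0)` has order `2`.** [folklore] -/
theorem Xs3b5Legendre_addOrderOf_Q :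
    addOrderOf (.some (-1) 0 Xs3b5Legendre_nonsingular_Q :
        (⟨0, 17, 0, 16, 0⟩ : WeierstrassCurve ℚ).toAffine.Point) = 2 := by
  refine addOrderOf_eq_prime ?_ (some_ne_zero _)
  rw [two_nsmul, Xs3b5Legendre_Q_add_Q]

/-- **`P = (4, 20)` has order `4`** (`2P = (0, 0) ≠ O`, `4P = O`). [folklore] -/
theorem Xs3b5Legendre_addOrderOf_P :
    addOrderOf (.some 4 20 Xs3b5Legendre_nonsingular_P :
        (⟨0, 17, 0, 16, 0⟩ : WeierstrassCurve ℚ).toAffine.Point) = 4 := by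
  have h2 : 2 • (.some 4 20 Xs3b5Legendre_nonsingular_P :
      (⟨0, 17, 0, 16, 0⟩ : WeierstrassCurve ℚ).toAffine.Point) =
        .some 0 0 Xs3b5Legendre_nonsingular_twoP := by
    rw [two_nsmul, Xs3b5Legendre_P_add_P]
  have h4 : 4 • (.some 4 20 Xs3b5Legendre_nonsingular_P :
      (⟨0, 17, 0, 16, 0⟩ : WeierstrassCurve ℚ).toAffine.Point) = 0 := by
    rw [show (4 : ℕ) = 2 * 2 from rfl, mul_nsmul, h2, two_nsmul, Xs3b5Legendre_twoP_add_twoP]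
  have := addOrderOf_eq_prime_pow (p := 2) (n := 1) (x := (.some 4 20
    Xs3b5Legendre_nonsingular_P : (⟨0, 17, 0, 16, 0⟩ : WeierstrassCurve ℚ).toAffine.Point)) ?_ ?_
  · simpa using this
  · rw [pow_one, h2]; exact some_ne_zero _
  · simpa using h4

/-- `2 • P = (0, 0)` (integer multiple). [folklore] -/
theorem Xs3b5Legendre_two_zsmul_P :
    (2 : ℤ) • (.some 4 20 Xs3b5Legendre_nonsingular_P :
        (⟨0, 17, 0, 16, 0⟩ : WeierstrassCurve ℚ).toAffine.Point) =
      .some 0 0 Xs3b5Legendre_nonsingular_twoP := by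
  rw [two_zsmul, Xs3b5Legendre_P_add_P]

/-- `3 • P = (4, -20) = -P` (integer multiple). [folklore] -/
theorem Xs3b5Legendre_three_zsmul_P :
    (3 : ℤ) • (.some 4 20 Xs3b5Legendre_nonsingular_P :
        (⟨0, 17, 0, 16, 0⟩ : WeierstrassCurve ℚ).toAffine.Point) =
      .some 4 (-20) Xs3b5Legendre_nonsingular_threeP := by
  rw [show (3 : ℤ) = 2 + 1 by norm_num, add_zsmul, one_zsmul, Xs3b5Legendre_two_zsmul_P,
    Xs3b5Legendre_twoP_add_P]

/-- `4 • P = O`. [folklore] -/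
theorem Xs3b5Legendre_four_zsmul_P :
    (4 : ℤ) • (.some 4 20 Xs3b5Legendre_nonsingular_P :
        (⟨0, 17, 0, 16, 0⟩ : WeierstrassCurve ℚ).toAffine.Point) = 0 := by
  rw [show (4 : ℤ) = 2 + 2 by norm_num, add_zsmul, Xs3b5Legendre_two_zsmul_P,
    Xs3b5Legendre_twoP_add_twoP]

/-- **`Q ∉ ⟨P⟩`**: the multiples of `P` are `O, (4, 20), (0, 0), (4, -20)`, none of which is
`Q = (-1, 0)`. [folklore] -/
theorem Xs3b5Legendre_Q_not_mem_zmultiples_P :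
    (.some (-1) 0 Xs3b5Legendre_nonsingular_Q :
        (⟨0, 17, 0, 16, 0⟩ : WeierstrassCurve ℚ).toAffine.Point) ∉
      AddSubgroup.zmultiples (.some 4 20 Xs3b5Legendre_nonsingular_P) := by
  rw [AddSubgroup.mem_zmultiples_iff]
  rintro ⟨k, hk⟩
  rw [← mod_addOrderOf_zsmul, Xs3b5Legendre_addOrderOf_P] at hk
  push_cast at hk
  obtain h | h | h | h : k % 4 = 0 ∨ k % 4 = 1 ∨ k % 4 = 2 ∨ k % 4 = 3 := by omega
  · rw [h, zero_zsmul] at hk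
    exact some_ne_zero _ hk.symm
  · rw [h, one_zsmul, some.injEq] at hk
    norm_num at hk
  · rw [h, Xs3b5Legendre_two_zsmul_P, some.injEq] at hk
    norm_num at hk
  · rw [h, Xs3b5Legendre_three_zsmul_P, some.injEq] at hk
    norm_num at hk

/-- **`ℤ/4 × ℤ/2 ↪ X(s3, b5)(ℚ)`** on the printed Legendre model `y² = x(x + 1)(x + 16)`
(source, proof of Cor. 7.1.2: "We also have `X(s3, b5)(ℚ) ≅ ℤ/2ℤ × ℤ/4ℤ`"): `(a, b) ↦ aP + bQ`,
`P = (4, 20)`, `Q = (-1, 0)`, is an injective homomorphism. (Lower-bound half of the printed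
group structure; rank `0` — Cremona 15A3, `r = 0`, `|T| = 8` — is a `2`-descent not done here.)
[cite: CaraianiNewton2023, §7, proof of Cor. 7.1.2] -/
theorem Xs3b5Legendre_exists_zmod4_prod_zmod2_injective :
    ∃ f : ZMod 4 × ZMod 2 →+ (⟨0, 17, 0, 16, 0⟩ : WeierstrassCurve ℚ).toAffine.Point,
      Function.Injective f ∧
        f (1, 0) = .some 4 20 Xs3b5Legendre_nonsingular_P ∧
          f (0, 1) = .some (-1) 0 Xs3b5Legendre_nonsingular_Q := by
  set P : (⟨0, 17, 0, 16, 0⟩ : WeierstrassCurve ℚ).toAffine.Point :=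
    .some 4 20 Xs3b5Legendre_nonsingular_P with hPdef
  set Q : (⟨0, 17, 0, 16, 0⟩ : WeierstrassCurve ℚ).toAffine.Point :=
    .some (-1) 0 Xs3b5Legendre_nonsingular_Q with hQdef
  have hP4 : (zmultiplesHom _ P : ℤ →+ _) (4 : ℕ) = 0 := by
    rw [zmultiplesHom_apply, Nat.cast_ofNat, hPdef]
    exact Xs3b5Legendre_four_zsmul_P
  have hQ2 : (zmultiplesHom _ Q : ℤ →+ _) (2 : ℕ) = 0 := by
    rw [zmultiplesHom_apply, Nat.cast_ofNat, two_zsmul, hQdef]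
    exact Xs3b5Legendre_Q_add_Q
  let fP : ZMod 4 →+ (⟨0, 17, 0, 16, 0⟩ : WeierstrassCurve ℚ).toAffine.Point :=
    ZMod.lift 4 ⟨zmultiplesHom _ P, hP4⟩
  let fQ : ZMod 2 →+ (⟨0, 17, 0, 16, 0⟩ : WeierstrassCurve ℚ).toAffine.Point :=
    ZMod.lift 2 ⟨zmultiplesHom _ Q, hQ2⟩
  have hfP : ∀ k : ℤ, fP k = k • P := fun k ↦ by simp [fP]
  have hfQ : ∀ k : ℤ, fQ k = k • Q := fun k ↦ by simp [fQ]
  refine ⟨fP.coprod fQ, ?_, ?_, ?_⟩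
  · rw [injective_iff_map_eq_zero]
    rintro ⟨a, b⟩ hab
    rw [AddMonoidHom.coprod_apply] at hab
    obtain ⟨a, rfl⟩ := ZMod.intCast_surjective a
    obtain ⟨b, rfl⟩ := ZMod.intCast_surjective b
    rw [hfP, hfQ, ← mod_addOrderOf_zsmul Q, Xs3b5Legendre_addOrderOf_Q] at hab
    push_cast at hab
    obtain hb | hb : b % 2 = 0 ∨ b % 2 = 1 := by omega
    · rw [hb, zero_zsmul, add_zero] at hab
      have ha : (4 : ℤ) ∣ a := by
        have := addOrderOf_dvd_iff_zsmul_eq_zero.2 hab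
        rwa [Xs3b5Legendre_addOrderOf_P] at this
      refine Prod.ext ?_ ?_
      · simpa [ZMod.intCast_zmod_eq_zero_iff_dvd] using ha
      · have : (2 : ℤ) ∣ b := by omega
        simpa [ZMod.intCast_zmod_eq_zero_iff_dvd] using this
    · exfalso
      rw [hb, one_zsmul, add_eq_zero_iff_eq_neg, hQdef, neg_some] at hab
      simp only [Xs3b5Legendre_negY, _root_.neg_zero] at hab
      exact Xs3b5Legendre_Q_not_mem_zmultiples_P ⟨a, hab⟩
  · have h1 := hfP 1
    rw [Int.cast_one, one_zsmul] at h1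
    simpa only [AddMonoidHom.coprod_apply, _root_.map_zero, add_zero] using h1
  · have h1 := hfQ 1
    rw [Int.cast_one, one_zsmul] at h1
    simpa only [AddMonoidHom.coprod_apply, _root_.map_zero, zero_add] using h1

end TorsionXs3b5

end Literature.NumberTheory.Automorphic

end
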